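import Literature.Analysis.PDE.PatchResidualEnergy
import Literature.Analysis.PDE.HeatZeroEnergy
import Literature.Analysis.PDE.TimeExtension
import Literature.Analysis.PDE.TimeSobolevSup
import HarnessLib

/-!
# The flat local residual of a cut-off heat solution against a variable-coefficient operator:
# identity and energy bound (topic `Analysis/PDE`)

Fine level of the parametrix in the programme to prove short-time existence for quasilinear
strictly parabolic systems on a closed manifold (hypothesis `hQL` of
`Literature.Geometry.Riemannian.ricciFlow_shortTime_existence_of_quasilinear`). In adapted
Euclidean coordinates of one fine patch, a smooth `u` with `uₜ = Δu + θ` (flat heat equation with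
source) is cut off by `cut`; against the true operator `frameOp (S z) (𝔟 z) (𝔠 z)` the cut-off
function has the residual

  `cut • uₜ = frameOp S 𝔟 𝔠 (cut • u) + cut • θ - flatErr`,
  `flatErr = principalPart (S - 1) (cut • u) + 𝔟(D(cut • u)) + 𝔠(cut • u) + 2Σₗ ∂ₗcut • ∂ₗu + Δcut • u`

(`cut_smul_heat_eq`), and this file bounds its energy at every order `k` by GLOBAL energies of
`u` (`sobolevEnergy_flatErr_le`):

  `E_k(flatErr) ≤ 16 n² η² Σ_{ab} E_k(∂_a∂_b u) + C (Mc²+1)(Mcut²+1)² (Σ_a E_k(∂_a u) + E_k(u))`,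

where `η` bounds the cut-off top coefficients `cutP · ⟪b_a, (S - 1) b_b⟫` (`cutP = 1` on
`tsupport cut`), `Mc` their word derivatives and the cut-off lower coefficients, `Mcut` the word
derivatives of `cut` up to order `k + 2`, and `C` depends on `k` and the dimension only. The
second-order energies carry the small factor `η²` (sharp Leibniz rule, `|cut| ≤ 1`); everything
else is of order `≤ 1` in `u` (gain under the time weights of the heat engine).

Everything is proved; no named fact and no `sorry` is introduced.

## References

* L. C. Evans, *Partial Differential Equations*, 2nd ed., AMS 2010, §7.1.3. [Evans2010]
-/

noncomputable section

open Set Function Filter Topology Metric MeasureTheory InnerProductSpace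
open scoped ContDiff Topology ENNReal RealInnerProductSpace Laplacian

namespace Literature.Analysis.PDE

open Literature.Analysis.FunctionSpaces PatchSystemLoc

variable {E' : Type*} [NormedAddCommGroup E'] [InnerProductSpace ℝ E'] [FiniteDimensional ℝ E']
variable {F' : Type*} [NormedAddCommGroup F'] [InnerProductSpace ℝ F']

/-! ### The flat residual and the identity -/

/-- **The flat local residual** of the cut-off function `cut • u` against `frameOp S 𝔟 𝔠`:
`principalPart (S - 1) (cut • u) + 𝔟(D(cut • u)) + 𝔠(cut • u) + 2Σₗ ∂ₗcut • ∂ₗu + Δcut • u`.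
[cite: Evans2010, §7.1.3] -/
def flatErr (Ss : E' → (E' →L[ℝ] E')) (𝔟s : E' → ((E' →L[ℝ] F') →L[ℝ] F')) (𝔠s : E' → (F' →L[ℝ] F'))
    (cut : E' → ℝ) (u : E' → F') (z : E') : F' :=
  principalPart (Ss z - 1) (fun y ↦ cut y • u y) z + 𝔟s z (fderiv ℝ (fun y ↦ cut y • u y) z) +
    𝔠s z (cut z • u z) +
    (2 • ∑ l, fderiv ℝ cut z (stdOrthonormalBasis ℝ E' l) • fderiv ℝ u z (stdOrthonormalBasis ℝ E' l)) +
    (Δ cut) z • u z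

/-- `flatErr_apply`: unfolding. [folklore] -/
theorem flatErr_apply (Ss : E' → (E' →L[ℝ] E')) (𝔟s : E' → ((E' →L[ℝ] F') →L[ℝ] F'))
    (𝔠s : E' → (F' →L[ℝ] F')) (cut : E' → ℝ) (u : E' → F') (z : E') :
    flatErr Ss 𝔟s 𝔠s cut u z =
      principalPart (Ss z - 1) (fun y ↦ cut y • u y) z + 𝔟s z (fderiv ℝ (fun y ↦ cut y • u y) z) +
        𝔠s z (cut z • u z) +
        (2 • ∑ l, fderiv ℝ cut z (stdOrthonormalBasis ℝ E' l) • fderiv ℝ u z (stdOrthonormalBasis ℝ E' l)) +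
        (Δ cut) z • u z := rfl

/-- **The flat residual identity**: if `uₜ = Δu + θ` at `z` (flat heat equation with source) then
`cut • uₜ = frameOp S 𝔟 𝔠 (cut • u) + cut • θ - flatErr` at `z`. [cite: Evans2010, §7.1.3] -/
theorem cut_smul_heat_eq (Ss : E' → (E' →L[ℝ] E')) (𝔟s : E' → ((E' →L[ℝ] F') →L[ℝ] F'))
    (𝔠s : E' → (F' →L[ℝ] F')) {cut : E' → ℝ} (hcut : ContDiff ℝ ∞ cut) {u : E' → F'}
    (hu : ContDiff ℝ ∞ u) {uₜ θ : E' → F'} (z : E') (hpde : uₜ z = (Δ u) z + θ z) :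
    cut z • uₜ z = frameOp (Ss z) (𝔟s z) (𝔠s z) (fun y ↦ cut y • u y) z + cut z • θ z -
      flatErr Ss 𝔟s 𝔠s cut u z := by
  set b := stdOrthonormalBasis ℝ E'
  have hv : ContDiff ℝ ∞ fun y ↦ cut y • u y := hcut.smul hu
  have hsplit : principalPart (Ss z) (fun y ↦ cut y • u y) z =
      principalPart (Ss z - 1) (fun y ↦ cut y • u y) z + (Δ (fun y ↦ cut y • u y)) z := by
    rw [← principalPart_one (hv.of_le (by norm_cast)) z, ← principalPart_add, sub_add_cancel]
  have hΔ := laplacian_smul_of_tsupport_subset (g' := u) isOpen_univ hcut (subset_univ _) hu.contDiffOn z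
  have hΔu : (Δ u) z = ∑ l, fderiv ℝ (fun y ↦ fderiv ℝ u y (b l)) z (b l) :=
    Literature.Analysis.FluidPDE.laplacian_eq_sum_fderiv_fderiv_normed b (hu.of_le (by norm_cast)) z
  rw [frameOp_apply, hsplit, hΔ, flatErr_apply, hpde, hΔu]
  simp only [smul_add]
  abel

/-- **The flat residual vanishes off the support of the cut-off.** [folklore] -/
theorem flatErr_eq_zero_of_notMem_tsupport (Ss : E' → (E' →L[ℝ] E')) (𝔟s : E' → ((E' →L[ℝ] F') →L[ℝ] F'))
    (𝔠s : E' → (F' →L[ℝ] F')) {cut : E' → ℝ} (u : E' → F') {z : E'} (hz : z ∉ tsupport cut) :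
    flatErr Ss 𝔟s 𝔠s cut u z = 0 := by
  have hev : (cut : E' → ℝ) =ᶠ[𝓝 z] fun _ ↦ 0 := notMem_tsupport_iff_eventuallyEq.1 hz
  have h0 : cut z = 0 := hev.self_of_nhds
  have h1 : fderiv ℝ cut z = 0 := fderiv_of_notMem_tsupport ℝ hz
  have hev2 : (fun y ↦ cut y • u y) =ᶠ[𝓝 z] fun _ ↦ 0 := by
    filter_upwards [hev] with y hy; simp [hy]
  have h2 : fderiv ℝ (fun y ↦ cut y • u y) z = 0 := by rw [hev2.fderiv_eq]; simp
  have h3 : ∀ v, fderiv ℝ (fun y ↦ fderiv ℝ (fun x ↦ cut x • u x) y v) z = 0 := by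
    intro v
    have hev3 : (fun y ↦ fderiv ℝ (fun x ↦ cut x • u x) y v) =ᶠ[𝓝 z] fun _ ↦ 0 := by
      filter_upwards [eventually_eventuallyEq_nhds.2 hev2] with y hy
      rw [hy.fderiv_eq]; simp
    rw [hev3.fderiv_eq]; simp
  have h4 : (Δ cut) z = 0 := by
    rw [laplacian_eq_iteratedFDeriv_stdOrthonormalBasis]
    simp [(hev.iteratedFDeriv ℝ 2).self_of_nhds, iteratedFDeriv_const_of_ne two_ne_zero]
  rw [flatErr_apply, principalPart_apply]
  simp [h0, h1, h2, h3, h4]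

/-- **The flat residual is smooth** (smooth cut-off, function and coefficient slices). [folklore] -/
theorem contDiff_flatErr {Ss : E' → (E' →L[ℝ] E')} {𝔟s : E' → ((E' →L[ℝ] F') →L[ℝ] F')}
    {𝔠s : E' → (F' →L[ℝ] F')} (hS : ContDiff ℝ ∞ Ss) (h𝔟 : ContDiff ℝ ∞ 𝔟s) (h𝔠 : ContDiff ℝ ∞ 𝔠s)
    {cut : E' → ℝ} (hcut : ContDiff ℝ ∞ cut) {u : E' → F'} (hu : ContDiff ℝ ∞ u) :
    ContDiff ℝ ∞ (flatErr Ss 𝔟s 𝔠s cut u) := by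
  have hv : ContDiff ℝ ∞ fun y ↦ cut y • u y := hcut.smul hu
  have hv1 : ∀ v, ContDiff ℝ ∞ fun z ↦ fderiv ℝ (fun y ↦ cut y • u y) z v := fun v ↦
    (hv.fderiv_right (m := ∞) (by norm_cast)).clm_apply contDiff_const
  have hv2 : ∀ v w, ContDiff ℝ ∞ fun y ↦ fderiv ℝ (fun z ↦ fderiv ℝ (fun x ↦ cut x • u x) z v) y w :=
    fun v w ↦ ((hv1 v).fderiv_right (m := ∞) (by norm_cast)).clm_apply contDiff_const
  have hd1 : ∀ v, ContDiff ℝ ∞ fun z ↦ fderiv ℝ u z v := fun v ↦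
    (hu.fderiv_right (m := ∞) (by norm_cast)).clm_apply contDiff_const
  have hc1 : ∀ v, ContDiff ℝ ∞ fun z ↦ fderiv ℝ cut z v := fun v ↦ contDiff_fderiv_apply_of_contDiff hcut v
  have hP : ContDiff ℝ ∞ fun z ↦ principalPart (Ss z - 1) (fun y ↦ cut y • u y) z := by
    have heq : (fun z ↦ principalPart (Ss z - 1) (fun y ↦ cut y • u y) z) = fun z ↦ ∑ a, ∑ l,
        ⟪stdOrthonormalBasis ℝ E' a, (Ss z - 1) (stdOrthonormalBasis ℝ E' l)⟫ •
        fderiv ℝ (fun y ↦ fderiv ℝ (fun x ↦ cut x • u x) y (stdOrthonormalBasis ℝ E' l)) z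
          (stdOrthonormalBasis ℝ E' a) := by
      funext z; rw [principalPart_apply]
    rw [heq]
    exact ContDiff.sum fun a _ ↦ ContDiff.sum fun l _ ↦
      (contDiff_const.inner ℝ ((hS.sub contDiff_const).clm_apply contDiff_const)).smul (hv2 _ _)
  have hB : ContDiff ℝ ∞ fun z ↦ 𝔟s z (fderiv ℝ (fun y ↦ cut y • u y) z) :=
    h𝔟.clm_apply (hv.fderiv_right (m := ∞) (by norm_cast))
  have hC : ContDiff ℝ ∞ fun z ↦ 𝔠s z (cut z • u z) := h𝔠.clm_apply hv
  have h7 : ContDiff ℝ ∞ fun z ↦ (2 • ∑ l, fderiv ℝ cut z (stdOrthonormalBasis ℝ E' l) •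
      fderiv ℝ u z (stdOrthonormalBasis ℝ E' l)) :=
    (ContDiff.sum fun l _ ↦ (hc1 _).smul (hd1 _)).const_smul _
  have h8 : ContDiff ℝ ∞ fun z ↦ (Δ cut) z • u z := (contDiff_laplacian_of_contDiff hcut).smul hu
  have heq : flatErr Ss 𝔟s 𝔠s cut u = fun z ↦ principalPart (Ss z - 1) (fun y ↦ cut y • u y) z +
      𝔟s z (fderiv ℝ (fun y ↦ cut y • u y) z) + 𝔠s z (cut z • u z) +
      (2 • ∑ l, fderiv ℝ cut z (stdOrthonormalBasis ℝ E' l) • fderiv ℝ u z (stdOrthonormalBasis ℝ E' l)) +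
      (Δ cut) z • u z := rfl
  rw [heq]
  exact (((hP.add hB).add hC).add h7).add h8

/-! ### Sharp Leibniz with `ε = 1`, all orders -/

section Energy

variable [MeasurableSpace E'] [BorelSpace E']

/-- **Sharp product rule with `ε = 1`**, uniform statement for all orders: for each `k` there is
`C < ∞` (`C = 0` for `k = 0`) with `E_k(m • g) ≤ 2 M₀² E_k(g) + C M² E_{k-1}(g)` whenever
`|m| ≤ M₀` and the word derivatives of `m` of length `≤ k` are bounded by `M`.
[cite: Evans2010, §5.2.3, Thm. 1] -/
theorem sobolevEnergy_smul_le_sharp_one (k : ℕ) :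
    ∃ C : ℝ≥0∞, C ≠ ⊤ ∧ (k = 0 → C = 0) ∧ ∀ {m : E' → ℝ} {g : E' → F'},
      ContDiff ℝ ∞ m → ContDiff ℝ ∞ g → ∀ {M₀ M : ℝ}, (∀ x, |m x| ≤ M₀) →
      (∀ l : List (Fin (Module.finrank ℝ E')), l ≠ [] → l.length ≤ k →
        ∀ x, ‖iterDirDeriv (l.map (stdOrthonormalBasis ℝ E')) m x‖ ≤ M) →
      sobolevEnergy k (fun x ↦ m x • g x) ≤
        2 * ENNReal.ofReal (M₀ ^ 2) * sobolevEnergy k g + C * ENNReal.ofReal (M ^ 2) * sobolevEnergy (k - 1) g := by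
  cases k with
  | zero =>
    refine ⟨0, ENNReal.zero_ne_top, fun _ ↦ rfl, ?_⟩
    intro m g _ _ M₀ M h0 _
    calc sobolevEnergy 0 (fun x ↦ m x • g x) ≤ ENNReal.ofReal (M₀ ^ 2) * sobolevEnergy 0 g :=
          sobolevEnergy_smul_le_zero h0 g
      _ ≤ 2 * ENNReal.ofReal (M₀ ^ 2) * sobolevEnergy 0 g := by
          rw [mul_assoc]; exact le_mul_of_one_le_left bot_le (by norm_num)
      _ ≤ _ := le_self_add
  | succ j =>
    obtain ⟨C, hCtop, hC⟩ := sobolevEnergy_smul_le_sharp (E := E') (F := F') j one_pos le_rfl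
    refine ⟨C, hCtop, fun h ↦ absurd h (Nat.succ_ne_zero j), ?_⟩
    intro m g hm hg M₀ M h0 h1
    have h := hC hm hg h0 h1
    have h2 : ENNReal.ofReal (1 + 1) = 2 := by norm_num
    rw [h2] at h
    simpa using h

/-- The order-`k-1` energy of a second frame derivative is bounded by the order-`k` energy of the
first derivative (`k ≥ 1`); multiplied by a constant vanishing for `k = 0`, for all `k`.
[folklore] -/
theorem mul_sobolevEnergy_pred_fderiv_fderiv_le {C : ℝ≥0∞} {k : ℕ} (hC : k = 0 → C = 0) (u : E' → F')
    (a l : Fin (Module.finrank ℝ E')) :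
    C * sobolevEnergy (k - 1) (fun y ↦ fderiv ℝ (fun z ↦ fderiv ℝ u z (stdOrthonormalBasis ℝ E' l)) y
      (stdOrthonormalBasis ℝ E' a)) ≤
      C * sobolevEnergy k (fun z ↦ fderiv ℝ u z (stdOrthonormalBasis ℝ E' l)) := by
  cases k with
  | zero => simp [hC rfl]
  | succ j =>
    refine mul_le_mul' le_rfl ?_
    rw [Nat.add_sub_cancel, sobolevEnergy_succ]
    refine le_trans ?_ le_add_self
    exact Finset.single_le_sum (f := fun i ↦ sobolevEnergy j fun y ↦
      fderiv ℝ (fun z ↦ fderiv ℝ u z (stdOrthonormalBasis ℝ E' l)) y (stdOrthonormalBasis ℝ E' i))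
      (fun _ _ ↦ bot_le) (Finset.mem_univ a)

/-! ### The cut-off coefficient fields (general cut-off `cutP`) -/

omit [InnerProductSpace ℝ E'] [FiniteDimensional ℝ E'] [MeasurableSpace E'] [BorelSpace E'] in
/-- Inserting `cutP = 1` on `tsupport cut` in front of a quantity vanishing off `tsupport cut`.
[folklore] -/
theorem cutP_mul_eq {cut cutP : E' → ℝ} (h1 : ∀ z ∈ tsupport cut, cutP z = 1) {X : ℝ} {z : E'}
    (hX : z ∉ tsupport cut → X = 0) : cutP z * X = X := by
  by_cases hz : z ∈ tsupport cut
  · rw [h1 z hz, one_mul]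
  · rw [hX hz, mul_zero]

omit [InnerProductSpace ℝ E'] [FiniteDimensional ℝ E'] [MeasurableSpace E'] [BorelSpace E'] in
/-- Vector version of `cutP_mul_eq`. [folklore] -/
theorem cutP_smul_eq {cut cutP : E' → ℝ} (h1 : ∀ z ∈ tsupport cut, cutP z = 1) {X : F'} {z : E'}
    (hX : z ∉ tsupport cut → X = 0) : cutP z • X = X := by
  by_cases hz : z ∈ tsupport cut
  · rw [h1 z hz, one_smul]
  · rw [hX hz, smul_zero]

omit [FiniteDimensional ℝ E'] [MeasurableSpace E'] [BorelSpace E'] in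
/-- Derivatives of `cut • u` vanish off `tsupport cut`. [folklore] -/
theorem fderiv_cut_smul_eq_zero {cut : E' → ℝ} (u : E' → F') {z : E'} (hz : z ∉ tsupport cut) (v : E') :
    fderiv ℝ (fun y ↦ cut y • u y) z v = 0 := by
  have h : fderiv ℝ (fun y ↦ cut y • u y) z = 0 :=
    fderiv_of_notMem_tsupport ℝ fun h ↦ hz (tsupport_smul_subset_left _ _ h)
  rw [h]; rfl

omit [FiniteDimensional ℝ E'] [MeasurableSpace E'] [BorelSpace E'] in
/-- Second derivatives of `cut • u` vanish off `tsupport cut`. [folklore] -/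
theorem fderiv_fderiv_cut_smul_eq_zero {cut : E' → ℝ} (u : E' → F') {z : E'} (hz : z ∉ tsupport cut)
    (v w : E') : fderiv ℝ (fun y ↦ fderiv ℝ (fun x ↦ cut x • u x) y v) z w = 0 := by
  have h : fderiv ℝ (fun y ↦ fderiv ℝ (fun x ↦ cut x • u x) y v) z = 0 :=
    fderiv_of_notMem_tsupport ℝ fun h ↦ hz
      (tsupport_smul_subset_left _ _ (tsupport_fderiv_apply_subset ℝ v h))
  rw [h]; rfl

omit [MeasurableSpace E'] [BorelSpace E'] in
/-- The first-order coefficient term through cut-off coefficients (general cut-off):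
`𝔟(D(cut • u)) = Σₗ B_l (∂ₗ(cut • u))`, `B_l = cutP • 𝔟 ∘ smulRightL bₗ*`. [folklore] -/
theorem first_eq_sum_cutP {cut cutP : E' → ℝ} (h1 : ∀ z ∈ tsupport cut, cutP z = 1)
    (𝔟s : E' → ((E' →L[ℝ] F') →L[ℝ] F')) (u : E' → F') (z : E') :
    𝔟s z (fderiv ℝ (fun y ↦ cut y • u y) z) =
      ∑ l, (cutP z • ((𝔟s z).comp (ContinuousLinearMap.smulRightL ℝ E' F'
        (innerSL ℝ (stdOrthonormalBasis ℝ E' l)))))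
        (fderiv ℝ (fun y ↦ cut y • u y) z (stdOrthonormalBasis ℝ E' l)) := by
  conv_lhs => rw [clm_eq_sum_smulRight (fderiv ℝ (fun y ↦ cut y • u y) z), map_sum]
  refine Finset.sum_congr rfl fun l _ ↦ ?_
  rw [smul_apply, ContinuousLinearMap.comp_apply,
    ContinuousLinearMap.smulRightL_apply_apply]
  refine (cutP_smul_eq h1 fun hz ↦ ?_).symm
  rw [fderiv_cut_smul_eq_zero u hz]
  have h0 : ((innerSL ℝ) (stdOrthonormalBasis ℝ E' l)).smulRight (0 : F') = 0 := by ext; simp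
  rw [h0, map_zero]

omit [MeasurableSpace E'] [BorelSpace E'] in
/-- The top term through cut-off coefficients (general cut-off):
`principalPart (S-1) (cut • u) = Σ_{al} (cutP ⟪b_a,(S-1)b_l⟫) • ∂_a∂_l(cut • u)`. [folklore] -/
theorem principalPart_sub_one_eq_sum_cutP {cut cutP : E' → ℝ} (h1 : ∀ z ∈ tsupport cut, cutP z = 1)
    (Ss : E' → (E' →L[ℝ] E')) (u : E' → F') (z : E') :
    principalPart (Ss z - 1) (fun y ↦ cut y • u y) z =
      ∑ a, ∑ l, (cutP z * ⟪stdOrthonormalBasis ℝ E' a, (Ss z - 1) (stdOrthonormalBasis ℝ E' l)⟫) •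
        fderiv ℝ (fun y ↦ fderiv ℝ (fun x ↦ cut x • u x) y (stdOrthonormalBasis ℝ E' l)) z
          (stdOrthonormalBasis ℝ E' a) := by
  rw [principalPart_apply]
  refine Finset.sum_congr rfl fun a _ ↦ Finset.sum_congr rfl fun l _ ↦ ?_
  rw [mul_comm, mul_smul, cutP_smul_eq h1 fun hz ↦ fderiv_fderiv_cut_smul_eq_zero u hz _ _]

-- Heartbeat headroom (2026-08-16): this declaration elaborates in ≈ 110k–200k heartbeats (fails at
-- 110000, passed the gate at 200000, timed out at 200000 in the 2026-08-16 full build: run-to-run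
-- variance); doubled budget, proof unchanged.
set_option maxHeartbeats 400000 in
/-- **The energy of the flat local residual.** For every order `k` there is `C < ∞` (depending on
`k` and the dimension only) such that, for all smooth `u`, cut-offs `cut` (`|cut| ≤ 1`), `cutP`
(`= 1` on `tsupport cut`), coefficient slices `S, 𝔟, 𝔠`, and bounds `η ∈ [0, 1]` (of the cut-off
top coefficients `cutP ⟪b_a, (S-1) b_l⟫`), `Mc ≥ 0` (of these and the cut-off lower coefficients
with their word derivatives of length `≤ k`), `Mcut ≥ 1` (of `cut, ∂cut, ∂∂cut, Δcut` with word
derivatives of length `≤ k`):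
`E_k(flatErr) ≤ 80 n² η² Σ_{al} E_k(∂_a∂_l u) + C (Mc²+1) Mcut² (Σ_l E_k(∂_l u) + E_k(u))`.
[cite: Evans2010, §7.1.3] -/
theorem sobolevEnergy_flatErr_le (k : ℕ) :
    ∃ C : ℝ≥0∞, C ≠ ⊤ ∧ ∀ {Ss : E' → (E' →L[ℝ] E')} {𝔟s : E' → ((E' →L[ℝ] F') →L[ℝ] F')}
      {𝔠s : E' → (F' →L[ℝ] F')} {cut cutP : E' → ℝ} {u : E' → F'} {η Mc Mcut : ℝ},
      ContDiff ℝ ∞ cut → ContDiff ℝ ∞ u → (∀ z ∈ tsupport cut, cutP z = 1) →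
      -- the cut-off and its derived multipliers
      (∀ z, |cut z| ≤ 1) → 1 ≤ Mcut →
      (∀ lst : List (Fin (Module.finrank ℝ E')), lst ≠ [] → lst.length ≤ k →
        ∀ z, ‖iterDirDeriv (lst.map (stdOrthonormalBasis ℝ E')) cut z‖ ≤ Mcut) →
      (∀ a z, |fderiv ℝ cut z (stdOrthonormalBasis ℝ E' a)| ≤ Mcut) →
      (∀ a, ∀ lst : List (Fin (Module.finrank ℝ E')), lst ≠ [] → lst.length ≤ k →
        ∀ z, ‖iterDirDeriv (lst.map (stdOrthonormalBasis ℝ E'))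
          (fun z ↦ fderiv ℝ cut z (stdOrthonormalBasis ℝ E' a)) z‖ ≤ Mcut) →
      (∀ a l z, |fderiv ℝ (fun y ↦ fderiv ℝ cut y (stdOrthonormalBasis ℝ E' l)) z
        (stdOrthonormalBasis ℝ E' a)| ≤ Mcut) →
      (∀ a l, ∀ lst : List (Fin (Module.finrank ℝ E')), lst ≠ [] → lst.length ≤ k →
        ∀ z, ‖iterDirDeriv (lst.map (stdOrthonormalBasis ℝ E')) (fun z ↦ fderiv ℝ
          (fun y ↦ fderiv ℝ cut y (stdOrthonormalBasis ℝ E' l)) z (stdOrthonormalBasis ℝ E' a)) z‖ ≤ Mcut) →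
      (∀ z, |(Δ cut) z| ≤ Mcut) →
      (∀ lst : List (Fin (Module.finrank ℝ E')), lst ≠ [] → lst.length ≤ k →
        ∀ z, ‖iterDirDeriv (lst.map (stdOrthonormalBasis ℝ E')) (Δ cut) z‖ ≤ Mcut) →
      -- the cut-off coefficient fields
      (∀ a l, ContDiff ℝ ∞ fun z ↦ cutP z *
        ⟪stdOrthonormalBasis ℝ E' a, (Ss z - 1) (stdOrthonormalBasis ℝ E' l)⟫) →
      0 ≤ η → η ≤ 1 →
      (∀ a l z, |cutP z * ⟪stdOrthonormalBasis ℝ E' a, (Ss z - 1) (stdOrthonormalBasis ℝ E' l)⟫| ≤ η) →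
      0 ≤ Mc →
      (∀ a l z, |cutP z * ⟪stdOrthonormalBasis ℝ E' a, (Ss z - 1) (stdOrthonormalBasis ℝ E' l)⟫| ≤ Mc) →
      (∀ a l, ∀ lst : List (Fin (Module.finrank ℝ E')), lst ≠ [] → lst.length ≤ k →
        ∀ z, ‖iterDirDeriv (lst.map (stdOrthonormalBasis ℝ E')) (fun z ↦ cutP z *
          ⟪stdOrthonormalBasis ℝ E' a, (Ss z - 1) (stdOrthonormalBasis ℝ E' l)⟫) z‖ ≤ Mc) →
      (∀ l, ContDiff ℝ ∞ fun z ↦ cutP z • ((𝔟s z).comp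
        (ContinuousLinearMap.smulRightL ℝ E' F' (innerSL ℝ (stdOrthonormalBasis ℝ E' l))))) →
      (∀ l z, ‖cutP z • ((𝔟s z).comp
        (ContinuousLinearMap.smulRightL ℝ E' F' (innerSL ℝ (stdOrthonormalBasis ℝ E' l))))‖ ≤ Mc) →
      (∀ l, ∀ lst : List (Fin (Module.finrank ℝ E')), lst ≠ [] → lst.length ≤ k →
        ∀ z, ‖iterDirDeriv (lst.map (stdOrthonormalBasis ℝ E')) (fun z ↦ cutP z • ((𝔟s z).comp
          (ContinuousLinearMap.smulRightL ℝ E' F' (innerSL ℝ (stdOrthonormalBasis ℝ E' l))))) z‖ ≤ Mc) →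
      (ContDiff ℝ ∞ fun z ↦ cutP z • 𝔠s z) → (∀ z, ‖cutP z • 𝔠s z‖ ≤ Mc) →
      (∀ lst : List (Fin (Module.finrank ℝ E')), lst ≠ [] → lst.length ≤ k →
        ∀ z, ‖iterDirDeriv (lst.map (stdOrthonormalBasis ℝ E')) (fun z ↦ cutP z • 𝔠s z) z‖ ≤ Mc) →
      sobolevEnergy k (flatErr Ss 𝔟s 𝔠s cut u) ≤
        ENNReal.ofReal (80 * (Module.finrank ℝ E' : ℝ) ^ 2 * η ^ 2) * ∑ a, ∑ l,
            sobolevEnergy k (fun y ↦ fderiv ℝ (fun z ↦ fderiv ℝ u z (stdOrthonormalBasis ℝ E' l)) y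
              (stdOrthonormalBasis ℝ E' a)) +
          C * ENNReal.ofReal ((Mc ^ 2 + 1) * Mcut ^ 2) *
            (∑ l, sobolevEnergy k (fun z ↦ fderiv ℝ u z (stdOrthonormalBasis ℝ E' l)) + sobolevEnergy k u) := by
  classical
  -- universal constants
  obtain ⟨Csh, hCshtop, hCsh0, hCsh⟩ := sobolevEnergy_smul_le_sharp_one (E' := E') (F' := F') k
  obtain ⟨Ccr, hCcrtop, hCcr⟩ := sobolevEnergy_smul_le_crude (E := E') (F := F') k
  obtain ⟨Ccl, hCcltop, hCcl⟩ := sobolevEnergy_clm_apply_le_crude (E := E') (F := F') (G := F') k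
  obtain ⟨N, hN⟩ : ∃ N : ℝ≥0∞, N = (Module.finrank ℝ E' : ℝ≥0∞) := ⟨_, rfl⟩
  have hNtop : N ≠ ⊤ := by rw [hN]; exact ENNReal.natCast_ne_top _
  -- the total constant (generous)
  obtain ⟨C, hC⟩ : ∃ C : ℝ≥0∞, C = 5 * (N * N * (N * N) * (2 * (4 * Csh + 12 * Ccr) + 4 * Csh * Ccr) +
    4 * N * N * Ccl * Ccr + Ccl * Ccr + 4 * N * N * Ccr + Ccr) := ⟨_, rfl⟩
  have hCtop : C ≠ ⊤ := by
    rw [hC]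
    apply_rules [ENNReal.mul_ne_top, ENNReal.add_ne_top.2, And.intro] <;>
      first | assumption | norm_num
  refine ⟨C, hCtop, ?_⟩
  intro Ss 𝔟s 𝔠s cut cutP u η Mc Mcut hcut hu h1 hcut1 hMcut1 hw0 hd1 hw1 hd2 hw2 hdL hwL
    hA hη0 hη1 hAη hMc0 hA0 hAw hB hB0 hBw hCf hC0 hCw
  have hMcut0 : 0 ≤ Mcut := zero_le_one.trans hMcut1
  -- abbreviations for energies of `u`
  obtain ⟨Euu, hEuu⟩ : ∃ Euu : ℝ≥0∞, Euu = sobolevEnergy k u := ⟨_, rfl⟩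
  obtain ⟨Eu1, hEu1⟩ : ∃ Eu1 : Fin (Module.finrank ℝ E') → ℝ≥0∞,
      Eu1 = fun l ↦ sobolevEnergy k (fun z ↦ fderiv ℝ u z (stdOrthonormalBasis ℝ E' l)) := ⟨_, rfl⟩
  obtain ⟨Eu2, hEu2⟩ : ∃ Eu2 : Fin (Module.finrank ℝ E') → Fin (Module.finrank ℝ E') → ℝ≥0∞,
      Eu2 = fun a l ↦ sobolevEnergy k (fun y ↦ fderiv ℝ (fun z ↦ fderiv ℝ u z (stdOrthonormalBasis ℝ E' l)) y
        (stdOrthonormalBasis ℝ E' a)) := ⟨_, rfl⟩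
  obtain ⟨LOWu, hLOWu⟩ : ∃ LOWu : ℝ≥0∞, LOWu = ∑ l, Eu1 l + Euu := ⟨_, rfl⟩
  have hEu1le : ∀ l, Eu1 l ≤ LOWu := fun l ↦ by
    rw [hLOWu]; exact (Finset.single_le_sum (f := Eu1) (fun _ _ ↦ bot_le) (Finset.mem_univ l)).trans le_self_add
  have hEuule : Euu ≤ LOWu := by rw [hLOWu]; exact le_add_self
  -- the units of the lower-order constants
  obtain ⟨Ucut, hUcut⟩ : ∃ Ucut : ℝ≥0∞, Ucut = ENNReal.ofReal (Mcut ^ 2) := ⟨_, rfl⟩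
  obtain ⟨U, hU⟩ : ∃ U : ℝ≥0∞, U = ENNReal.ofReal ((Mc ^ 2 + 1) * Mcut ^ 2) := ⟨_, rfl⟩
  have hUle : Ucut ≤ U := by
    rw [hU, hUcut]; exact ENNReal.ofReal_le_ofReal (by nlinarith [sq_nonneg Mc, sq_nonneg Mcut])
  have hUmc : ENNReal.ofReal (Mc ^ 2) * Ucut ≤ U := by
    rw [hU, hUcut, ← ENNReal.ofReal_mul (sq_nonneg _)]
    exact ENNReal.ofReal_le_ofReal (by nlinarith [sq_nonneg Mc, sq_nonneg Mcut])
  have hη2 : ENNReal.ofReal (η ^ 2) ≤ 1 := by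
    rw [← ENNReal.ofReal_one]; exact ENNReal.ofReal_le_ofReal (by nlinarith)
  -- smoothness of the building blocks
  have hd1s : ∀ v, ContDiff ℝ ∞ fun z ↦ fderiv ℝ u z v := fun v ↦
    (hu.fderiv_right (m := ∞) (by norm_cast)).clm_apply contDiff_const
  have hd2s : ∀ v w, ContDiff ℝ ∞ fun y ↦ fderiv ℝ (fun z ↦ fderiv ℝ u z v) y w := fun v w ↦
    ((hd1s v).fderiv_right (m := ∞) (by norm_cast)).clm_apply contDiff_const
  have hc1s : ∀ a, ContDiff ℝ ∞ fun z ↦ fderiv ℝ cut z (stdOrthonormalBasis ℝ E' a) := fun a ↦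
    contDiff_fderiv_apply_of_contDiff hcut _
  have hc2s : ∀ a l, ContDiff ℝ ∞ fun z ↦ fderiv ℝ (fun y ↦ fderiv ℝ cut y (stdOrthonormalBasis ℝ E' l)) z
      (stdOrthonormalBasis ℝ E' a) := fun a l ↦ contDiff_fderiv_apply_of_contDiff (hc1s l) _
  have hcLs : ContDiff ℝ ∞ (Δ cut) := contDiff_laplacian_of_contDiff hcut
  have hv : ContDiff ℝ ∞ fun y ↦ cut y • u y := hcut.smul hu
  have hv1 : ∀ v, ContDiff ℝ ∞ fun z ↦ fderiv ℝ (fun y ↦ cut y • u y) z v := fun v ↦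
    (hv.fderiv_right (m := ∞) (by norm_cast)).clm_apply contDiff_const
  have hv2 : ∀ v w, ContDiff ℝ ∞ fun y ↦ fderiv ℝ (fun z ↦ fderiv ℝ (fun x ↦ cut x • u x) z v) y w :=
    fun v w ↦ ((hv1 v).fderiv_right (m := ∞) (by norm_cast)).clm_apply contDiff_const
  have hcut0 : ∀ z, |cut z| ≤ Mcut := fun z ↦ (hcut1 z).trans hMcut1
  -- Step 1: basic cut-off products (crude)
  have P1 : ∀ l, sobolevEnergy k (fun z ↦ cut z • fderiv ℝ u z (stdOrthonormalBasis ℝ E' l)) ≤ Ccr * Ucut * LOWu := by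
    intro l
    refine (hCcr hcut (hd1s _) hcut0 hw0).trans ?_
    rw [← hUcut]
    refine mul_le_mul' le_rfl ?_
    rw [← show Eu1 l = sobolevEnergy k (fun z ↦ fderiv ℝ u z (stdOrthonormalBasis ℝ E' l)) by rw [hEu1]]
    exact hEu1le l
  have P2 : ∀ a l, sobolevEnergy k (fun z ↦ fderiv ℝ cut z (stdOrthonormalBasis ℝ E' a) •
      fderiv ℝ u z (stdOrthonormalBasis ℝ E' l)) ≤ Ccr * Ucut * LOWu := by
    intro a l
    refine (hCcr (hc1s a) (hd1s _) (hd1 a) (hw1 a)).trans ?_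
    rw [← hUcut]
    refine mul_le_mul' le_rfl ?_
    rw [← show Eu1 l = sobolevEnergy k (fun z ↦ fderiv ℝ u z (stdOrthonormalBasis ℝ E' l)) by rw [hEu1]]
    exact hEu1le l
  have P3 : ∀ l, sobolevEnergy k (fun z ↦ fderiv ℝ cut z (stdOrthonormalBasis ℝ E' l) • u z) ≤ Ccr * Ucut * LOWu := by
    intro l
    refine (hCcr (hc1s l) hu (hd1 l) (hw1 l)).trans ?_
    rw [← hUcut, ← hEuu]
    exact mul_le_mul' le_rfl hEuule
  have P4 : ∀ a l, sobolevEnergy k (fun z ↦ fderiv ℝ (fun y ↦ fderiv ℝ cut y (stdOrthonormalBasis ℝ E' l)) z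
      (stdOrthonormalBasis ℝ E' a) • u z) ≤ Ccr * Ucut * LOWu := by
    intro a l
    refine (hCcr (hc2s a l) hu (hd2 a l) (hw2 a l)).trans ?_
    rw [← hUcut, ← hEuu]
    exact mul_le_mul' le_rfl hEuule
  have P5 : sobolevEnergy k (fun z ↦ (Δ cut) z • u z) ≤ Ccr * Ucut * LOWu := by
    refine (hCcr hcLs hu hdL hwL).trans ?_
    rw [← hUcut, ← hEuu]
    exact mul_le_mul' le_rfl hEuule
  have P6 : sobolevEnergy k (fun z ↦ cut z • u z) ≤ Ccr * Ucut * Euu := by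
    rw [hEuu, hUcut]; exact hCcr hcut hu hcut0 hw0
  -- Step 2: first derivatives of `cut • u`
  have D1eq : ∀ l, (fun z ↦ fderiv ℝ (fun y ↦ cut y • u y) z (stdOrthonormalBasis ℝ E' l)) =
      fun z ↦ cut z • fderiv ℝ u z (stdOrthonormalBasis ℝ E' l) + fderiv ℝ cut z (stdOrthonormalBasis ℝ E' l) • u z :=
    fun l ↦ fderiv_smul_of_tsupport_subset_eq isOpen_univ hcut (subset_univ _) hu.contDiffOn _
  have D1 : ∀ l, sobolevEnergy k (fun z ↦ fderiv ℝ (fun y ↦ cut y • u y) z (stdOrthonormalBasis ℝ E' l)) ≤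
      4 * Ccr * Ucut * LOWu := by
    intro l
    rw [D1eq l]
    refine (sobolevEnergy_add_le k ((hcut.smul (hd1s _)).of_le (by exact_mod_cast le_top))
      (((hc1s l).smul hu).of_le (by exact_mod_cast le_top))).trans ?_
    calc 2 * sobolevEnergy k (fun z ↦ cut z • fderiv ℝ u z (stdOrthonormalBasis ℝ E' l)) +
          2 * sobolevEnergy k (fun z ↦ fderiv ℝ cut z (stdOrthonormalBasis ℝ E' l) • u z)
        ≤ 2 * (Ccr * Ucut * LOWu) + 2 * (Ccr * Ucut * LOWu) :=
          add_le_add (mul_le_mul' le_rfl (P1 l)) (mul_le_mul' le_rfl (P3 l))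
      _ = 4 * Ccr * Ucut * LOWu := by ring
  -- Step 3: second derivatives of `cut • u` (sharp in `cut`)
  have D2 : ∀ a l, sobolevEnergy k (fun y ↦ fderiv ℝ (fun z ↦ fderiv ℝ (fun x ↦ cut x • u x) z
      (stdOrthonormalBasis ℝ E' l)) y (stdOrthonormalBasis ℝ E' a)) ≤
      8 * Eu2 a l + (4 * Csh + 12 * Ccr) * Ucut * LOWu := by
    intro a l
    have heq : (fun y ↦ fderiv ℝ (fun z ↦ fderiv ℝ (fun x ↦ cut x • u x) z (stdOrthonormalBasis ℝ E' l)) y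
        (stdOrthonormalBasis ℝ E' a)) = fun y ↦
        (cut y • fderiv ℝ (fun z ↦ fderiv ℝ u z (stdOrthonormalBasis ℝ E' l)) y (stdOrthonormalBasis ℝ E' a) +
          fderiv ℝ cut y (stdOrthonormalBasis ℝ E' a) • fderiv ℝ u y (stdOrthonormalBasis ℝ E' l)) +
        (fderiv ℝ cut y (stdOrthonormalBasis ℝ E' l) • fderiv ℝ u y (stdOrthonormalBasis ℝ E' a) +
          fderiv ℝ (fun z ↦ fderiv ℝ cut z (stdOrthonormalBasis ℝ E' l)) y (stdOrthonormalBasis ℝ E' a) • u y) := by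
      funext y
      rw [fderiv_fderiv_smul_of_tsupport_subset_apply isOpen_univ hcut (subset_univ _) hu.contDiffOn]
      abel
    rw [heq]
    have s1 : ContDiff ℝ k fun y ↦ cut y • fderiv ℝ (fun z ↦ fderiv ℝ u z (stdOrthonormalBasis ℝ E' l)) y
        (stdOrthonormalBasis ℝ E' a) := (hcut.smul (hd2s _ _)).of_le (by exact_mod_cast le_top)
    have s2 : ContDiff ℝ k fun y ↦ fderiv ℝ cut y (stdOrthonormalBasis ℝ E' a) • fderiv ℝ u y
        (stdOrthonormalBasis ℝ E' l) := ((hc1s a).smul (hd1s _)).of_le (by exact_mod_cast le_top)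
    have s3 : ContDiff ℝ k fun y ↦ fderiv ℝ cut y (stdOrthonormalBasis ℝ E' l) • fderiv ℝ u y
        (stdOrthonormalBasis ℝ E' a) := ((hc1s l).smul (hd1s _)).of_le (by exact_mod_cast le_top)
    have s4 : ContDiff ℝ k fun y ↦ fderiv ℝ (fun z ↦ fderiv ℝ cut z (stdOrthonormalBasis ℝ E' l)) y
        (stdOrthonormalBasis ℝ E' a) • u y := ((hc2s a l).smul hu).of_le (by exact_mod_cast le_top)
    have hsharp : sobolevEnergy k (fun y ↦ cut y • fderiv ℝ (fun z ↦ fderiv ℝ u z (stdOrthonormalBasis ℝ E' l)) y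
        (stdOrthonormalBasis ℝ E' a)) ≤ 2 * Eu2 a l + Csh * Ucut * LOWu := by
      have h := hCsh (g := fun y ↦ fderiv ℝ (fun z ↦ fderiv ℝ u z (stdOrthonormalBasis ℝ E' l)) y
        (stdOrthonormalBasis ℝ E' a)) hcut (hd2s _ _) hcut1 hw0 (M₀ := 1)
      refine h.trans ?_
      have h2 := mul_sobolevEnergy_pred_fderiv_fderiv_le (C := Csh * ENNReal.ofReal (Mcut ^ 2)) (k := k)
        (fun hk ↦ by rw [hCsh0 hk, zero_mul]) u a l
      refine (add_le_add le_rfl h2).trans ?_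
      rw [one_pow, ENNReal.ofReal_one, mul_one, ← hUcut, hEu2]
      refine add_le_add le_rfl ?_
      rw [mul_assoc, mul_assoc]
      refine mul_le_mul' le_rfl (mul_le_mul' le_rfl ?_)
      rw [← show Eu1 l = sobolevEnergy k (fun z ↦ fderiv ℝ u z (stdOrthonormalBasis ℝ E' l)) by rw [hEu1]]
      exact hEu1le l
    calc _ ≤ 2 * sobolevEnergy k (fun y ↦ cut y • fderiv ℝ (fun z ↦ fderiv ℝ u z (stdOrthonormalBasis ℝ E' l)) y
            (stdOrthonormalBasis ℝ E' a) + fderiv ℝ cut y (stdOrthonormalBasis ℝ E' a) • fderiv ℝ u y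
            (stdOrthonormalBasis ℝ E' l)) +
          2 * sobolevEnergy k (fun y ↦ fderiv ℝ cut y (stdOrthonormalBasis ℝ E' l) • fderiv ℝ u y
            (stdOrthonormalBasis ℝ E' a) + fderiv ℝ (fun z ↦ fderiv ℝ cut z (stdOrthonormalBasis ℝ E' l)) y
            (stdOrthonormalBasis ℝ E' a) • u y) := sobolevEnergy_add_le k (s1.add s2) (s3.add s4)
      _ ≤ 2 * (2 * sobolevEnergy k (fun y ↦ cut y • fderiv ℝ (fun z ↦ fderiv ℝ u z (stdOrthonormalBasis ℝ E' l)) y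
            (stdOrthonormalBasis ℝ E' a)) + 2 * sobolevEnergy k (fun y ↦ fderiv ℝ cut y (stdOrthonormalBasis ℝ E' a) •
            fderiv ℝ u y (stdOrthonormalBasis ℝ E' l))) +
          2 * (2 * sobolevEnergy k (fun y ↦ fderiv ℝ cut y (stdOrthonormalBasis ℝ E' l) • fderiv ℝ u y
            (stdOrthonormalBasis ℝ E' a)) + 2 * sobolevEnergy k (fun y ↦ fderiv ℝ (fun z ↦ fderiv ℝ cut z
            (stdOrthonormalBasis ℝ E' l)) y (stdOrthonormalBasis ℝ E' a) • u y)) :=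
          add_le_add (mul_le_mul' le_rfl (sobolevEnergy_add_le k s1 s2)) (mul_le_mul' le_rfl (sobolevEnergy_add_le k s3 s4))
      _ ≤ 2 * (2 * (2 * Eu2 a l + Csh * Ucut * LOWu) + 2 * (Ccr * Ucut * LOWu)) +
          2 * (2 * (Ccr * Ucut * LOWu) + 2 * (Ccr * Ucut * LOWu)) :=
          add_le_add (mul_le_mul' le_rfl (add_le_add (mul_le_mul' le_rfl hsharp) (mul_le_mul' le_rfl (P2 a l))))
            (mul_le_mul' le_rfl (add_le_add (mul_le_mul' le_rfl (P2 l a)) (mul_le_mul' le_rfl (P4 a l))))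
      _ = 8 * Eu2 a l + (4 * Csh + 12 * Ccr) * Ucut * LOWu := by ring
  -- Step 4: the five terms of `flatErr`
  obtain ⟨K₁, hK₁⟩ : ∃ K₁ : ℝ≥0∞, K₁ = 2 * (4 * Csh + 12 * Ccr) + 4 * Csh * Ccr := ⟨_, rfl⟩
  -- (T1) the top term
  have T1 : sobolevEnergy k (fun z ↦ principalPart (Ss z - 1) (fun y ↦ cut y • u y) z) ≤
      ENNReal.ofReal (16 * η ^ 2) * (N * N) * ∑ a, ∑ l, Eu2 a l + N * N * (N * N) * K₁ * U * LOWu := by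
    have heq : (fun z ↦ principalPart (Ss z - 1) (fun y ↦ cut y • u y) z) = fun z ↦
        ∑ al : Fin (Module.finrank ℝ E') × Fin (Module.finrank ℝ E'),
          (cutP z * ⟪stdOrthonormalBasis ℝ E' al.1, (Ss z - 1) (stdOrthonormalBasis ℝ E' al.2)⟫) •
          fderiv ℝ (fun y ↦ fderiv ℝ (fun x ↦ cut x • u x) y (stdOrthonormalBasis ℝ E' al.2)) z
            (stdOrthonormalBasis ℝ E' al.1) := by
      funext z; rw [principalPart_sub_one_eq_sum_cutP h1, Fintype.sum_prod_type]
    rw [heq]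
    have hterm : ∀ al : Fin (Module.finrank ℝ E') × Fin (Module.finrank ℝ E'),
        sobolevEnergy k (fun z ↦ (cutP z * ⟪stdOrthonormalBasis ℝ E' al.1, (Ss z - 1)
          (stdOrthonormalBasis ℝ E' al.2)⟫) • fderiv ℝ (fun y ↦ fderiv ℝ (fun x ↦ cut x • u x) y
          (stdOrthonormalBasis ℝ E' al.2)) z (stdOrthonormalBasis ℝ E' al.1)) ≤
        ENNReal.ofReal (16 * η ^ 2) * Eu2 al.1 al.2 + K₁ * U * LOWu := by
      rintro ⟨a, l⟩
      have h := hCsh (g := fun y ↦ fderiv ℝ (fun z ↦ fderiv ℝ (fun x ↦ cut x • u x) z (stdOrthonormalBasis ℝ E' l)) y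
        (stdOrthonormalBasis ℝ E' a)) (hA a l) (hv2 _ _) (hAη a l) (hAw a l)
      refine h.trans ?_
      have hpred := mul_sobolevEnergy_pred_fderiv_fderiv_le (C := Csh * ENNReal.ofReal (Mc ^ 2)) (k := k)
        (fun hk ↦ by rw [hCsh0 hk, zero_mul]) (fun x ↦ cut x • u x) a l
      calc 2 * ENNReal.ofReal (η ^ 2) * sobolevEnergy k (fun y ↦ fderiv ℝ (fun z ↦ fderiv ℝ (fun x ↦ cut x • u x) z
            (stdOrthonormalBasis ℝ E' l)) y (stdOrthonormalBasis ℝ E' a)) +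
            Csh * ENNReal.ofReal (Mc ^ 2) * sobolevEnergy (k - 1) (fun y ↦ fderiv ℝ (fun z ↦ fderiv ℝ
            (fun x ↦ cut x • u x) z (stdOrthonormalBasis ℝ E' l)) y (stdOrthonormalBasis ℝ E' a))
          ≤ 2 * ENNReal.ofReal (η ^ 2) * (8 * Eu2 a l + (4 * Csh + 12 * Ccr) * Ucut * LOWu) +
            Csh * ENNReal.ofReal (Mc ^ 2) * (4 * Ccr * Ucut * LOWu) :=
            add_le_add (mul_le_mul' le_rfl (D2 a l)) (hpred.trans (mul_le_mul' le_rfl (D1 l)))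
        _ = ENNReal.ofReal (η ^ 2) * 16 * Eu2 a l +
            (ENNReal.ofReal (η ^ 2) * (2 * (4 * Csh + 12 * Ccr)) * Ucut +
              4 * Csh * Ccr * (ENNReal.ofReal (Mc ^ 2) * Ucut)) * LOWu := by ring
        _ ≤ ENNReal.ofReal (η ^ 2) * 16 * Eu2 a l +
            (1 * (2 * (4 * Csh + 12 * Ccr)) * U + 4 * Csh * Ccr * U) * LOWu := by gcongr
        _ = ENNReal.ofReal (16 * η ^ 2) * Eu2 a l + K₁ * U * LOWu := by
            rw [hK₁, show (16 : ℝ) * η ^ 2 = η ^ 2 * 16 by ring, ENNReal.ofReal_mul (sq_nonneg _)]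
            norm_num
            ring
    calc _ ≤ (Finset.univ.card : ℝ≥0∞) * ∑ al : Fin (Module.finrank ℝ E') × Fin (Module.finrank ℝ E'),
          sobolevEnergy k (fun z ↦ (cutP z * ⟪stdOrthonormalBasis ℝ E' al.1, (Ss z - 1)
            (stdOrthonormalBasis ℝ E' al.2)⟫) • fderiv ℝ (fun y ↦ fderiv ℝ (fun x ↦ cut x • u x) y
            (stdOrthonormalBasis ℝ E' al.2)) z (stdOrthonormalBasis ℝ E' al.1)) :=
          sobolevEnergy_sum_le_card k Finset.univ fun al _ ↦
            ((hA al.1 al.2).smul (hv2 _ _)).of_le (by exact_mod_cast le_top)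
      _ ≤ (N * N) * ∑ al : Fin (Module.finrank ℝ E') × Fin (Module.finrank ℝ E'),
          (ENNReal.ofReal (16 * η ^ 2) * Eu2 al.1 al.2 + K₁ * U * LOWu) := by
          refine mul_le_mul' (le_of_eq ?_) (Finset.sum_le_sum fun al _ ↦ hterm al)
          rw [Finset.card_univ, Fintype.card_prod, Fintype.card_fin, hN]; push_cast; ring
      _ = ENNReal.ofReal (16 * η ^ 2) * (N * N) * ∑ a, ∑ l, Eu2 a l + N * N * (N * N) * K₁ * U * LOWu := by
          rw [Finset.sum_add_distrib, Finset.sum_const, Finset.card_univ, Fintype.card_prod, Fintype.card_fin,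
            nsmul_eq_mul, ← Finset.mul_sum, Fintype.sum_prod_type, hN]
          push_cast
          ring
  -- (T2) the first-order coefficient term
  have T2 : sobolevEnergy k (fun z ↦ 𝔟s z (fderiv ℝ (fun y ↦ cut y • u y) z)) ≤ 4 * N * N * Ccl * Ccr * U * LOWu := by
    have heq : (fun z ↦ 𝔟s z (fderiv ℝ (fun y ↦ cut y • u y) z)) = fun z ↦
        ∑ l, (cutP z • ((𝔟s z).comp (ContinuousLinearMap.smulRightL ℝ E' F'
          (innerSL ℝ (stdOrthonormalBasis ℝ E' l)))))
          (fderiv ℝ (fun y ↦ cut y • u y) z (stdOrthonormalBasis ℝ E' l)) :=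
      funext fun z ↦ first_eq_sum_cutP h1 𝔟s u z
    rw [heq]
    have hsm : ∀ l, ContDiff ℝ k fun z ↦ (cutP z • ((𝔟s z).comp (ContinuousLinearMap.smulRightL ℝ E' F'
        (innerSL ℝ (stdOrthonormalBasis ℝ E' l))))) (fderiv ℝ (fun y ↦ cut y • u y) z (stdOrthonormalBasis ℝ E' l)) :=
      fun l ↦ ((hB l).clm_apply (hv1 _)).of_le (by exact_mod_cast le_top)
    calc _ ≤ (Finset.univ.card : ℝ≥0∞) * ∑ l, sobolevEnergy k (fun z ↦ (cutP z • ((𝔟s z).comp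
          (ContinuousLinearMap.smulRightL ℝ E' F' (innerSL ℝ (stdOrthonormalBasis ℝ E' l)))))
          (fderiv ℝ (fun y ↦ cut y • u y) z (stdOrthonormalBasis ℝ E' l))) :=
          sobolevEnergy_sum_le_card k Finset.univ fun l _ ↦ hsm l
      _ ≤ N * ∑ _l : Fin (Module.finrank ℝ E'), Ccl * ENNReal.ofReal (Mc ^ 2) * (4 * Ccr * Ucut * LOWu) := by
          rw [Finset.card_univ, Fintype.card_fin, hN]
          exact mul_le_mul' le_rfl (Finset.sum_le_sum fun l _ ↦
            (hCcl (hB l) (hv1 _) (hB0 l) (hBw l)).trans (mul_le_mul' le_rfl (D1 l)))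
      _ = N * N * (4 * Ccl * Ccr * (ENNReal.ofReal (Mc ^ 2) * Ucut) * LOWu) := by
          rw [Finset.sum_const, Finset.card_univ, Fintype.card_fin, nsmul_eq_mul, hN]; ring
      _ ≤ N * N * (4 * Ccl * Ccr * U * LOWu) := by gcongr
      _ = 4 * N * N * Ccl * Ccr * U * LOWu := by ring
  -- (T3) the zeroth-order coefficient term
  have T3 : sobolevEnergy k (fun z ↦ 𝔠s z (cut z • u z)) ≤ Ccl * Ccr * U * LOWu := by
    have heq : (fun z ↦ 𝔠s z (cut z • u z)) = fun z ↦ (cutP z • 𝔠s z) (cut z • u z) := by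
      funext z
      rw [smul_apply]
      refine (cutP_smul_eq h1 fun hz ↦ ?_).symm
      rw [image_eq_zero_of_notMem_tsupport hz, zero_smul, map_zero]
    rw [heq]
    refine (hCcl hCf (hcut.smul hu) hC0 hCw).trans ?_
    refine (mul_le_mul' le_rfl P6).trans ?_
    calc Ccl * ENNReal.ofReal (Mc ^ 2) * (Ccr * Ucut * Euu) = Ccl * Ccr * (ENNReal.ofReal (Mc ^ 2) * Ucut) * Euu := by ring
      _ ≤ Ccl * Ccr * U * LOWu := by gcongr
  -- (T4) the gradient-commutator term
  have T4 : sobolevEnergy k (fun z ↦ (2 • ∑ l, fderiv ℝ cut z (stdOrthonormalBasis ℝ E' l) •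
      fderiv ℝ u z (stdOrthonormalBasis ℝ E' l))) ≤ 4 * N * N * Ccr * U * LOWu := by
    have heq : (fun z ↦ (2 • ∑ l, fderiv ℝ cut z (stdOrthonormalBasis ℝ E' l) •
        fderiv ℝ u z (stdOrthonormalBasis ℝ E' l))) = fun z ↦ (2 : ℝ) • ∑ l, fderiv ℝ cut z (stdOrthonormalBasis ℝ E' l) •
        fderiv ℝ u z (stdOrthonormalBasis ℝ E' l) := by
      funext z; rw [two_smul, two_smul]
    rw [heq]
    have hsm : ContDiff ℝ k fun z ↦ ∑ l, fderiv ℝ cut z (stdOrthonormalBasis ℝ E' l) •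
        fderiv ℝ u z (stdOrthonormalBasis ℝ E' l) :=
      (ContDiff.sum fun l _ ↦ (hc1s l).smul (hd1s _)).of_le (by exact_mod_cast le_top)
    rw [sobolevEnergy_const_smul k hsm]
    have h4 : ‖(2 : ℝ)‖ₑ ^ 2 = 4 := by
      rw [← ofReal_norm, Real.norm_eq_abs, abs_two, ← ENNReal.ofReal_pow zero_le_two]; norm_num
    rw [h4]
    calc 4 * sobolevEnergy k (fun z ↦ ∑ l, fderiv ℝ cut z (stdOrthonormalBasis ℝ E' l) •
          fderiv ℝ u z (stdOrthonormalBasis ℝ E' l))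
        ≤ 4 * ((Finset.univ.card : ℝ≥0∞) * ∑ l, sobolevEnergy k (fun z ↦ fderiv ℝ cut z (stdOrthonormalBasis ℝ E' l) •
            fderiv ℝ u z (stdOrthonormalBasis ℝ E' l))) :=
          mul_le_mul' le_rfl (sobolevEnergy_sum_le_card k Finset.univ fun l _ ↦
            ((hc1s l).smul (hd1s _)).of_le (by exact_mod_cast le_top))
      _ ≤ 4 * (N * ∑ _l : Fin (Module.finrank ℝ E'), Ccr * Ucut * LOWu) := by
          rw [Finset.card_univ, Fintype.card_fin, hN]
          exact mul_le_mul' le_rfl (mul_le_mul' le_rfl (Finset.sum_le_sum fun l _ ↦ P2 l l))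
      _ = 4 * N * N * Ccr * Ucut * LOWu := by
          rw [Finset.sum_const, Finset.card_univ, Fintype.card_fin, nsmul_eq_mul, hN]; ring
      _ ≤ 4 * N * N * Ccr * U * LOWu := by gcongr
  -- (T5) the Laplacian-commutator term
  have T5 : sobolevEnergy k (fun z ↦ (Δ cut) z • u z) ≤ Ccr * U * LOWu :=
    P5.trans (by gcongr)
  -- Step 5: assemble (`E(Σ₅) ≤ 5 Σ E`)
  set TT : Fin 5 → E' → F' := ![fun z ↦ principalPart (Ss z - 1) (fun y ↦ cut y • u y) z,
    fun z ↦ 𝔟s z (fderiv ℝ (fun y ↦ cut y • u y) z), fun z ↦ 𝔠s z (cut z • u z),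
    fun z ↦ (2 • ∑ l, fderiv ℝ cut z (stdOrthonormalBasis ℝ E' l) • fderiv ℝ u z (stdOrthonormalBasis ℝ E' l)),
    fun z ↦ (Δ cut) z • u z] with hTT
  have hT1s : ContDiff ℝ k fun z ↦ principalPart (Ss z - 1) (fun y ↦ cut y • u y) z := by
    have heq : (fun z ↦ principalPart (Ss z - 1) (fun y ↦ cut y • u y) z) = fun z ↦ ∑ a, ∑ l,
        (cutP z * ⟪stdOrthonormalBasis ℝ E' a, (Ss z - 1) (stdOrthonormalBasis ℝ E' l)⟫) •
        fderiv ℝ (fun y ↦ fderiv ℝ (fun x ↦ cut x • u x) y (stdOrthonormalBasis ℝ E' l)) z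
          (stdOrthonormalBasis ℝ E' a) := funext fun z ↦ principalPart_sub_one_eq_sum_cutP h1 Ss u z
    rw [heq]
    exact (ContDiff.sum fun a _ ↦ ContDiff.sum fun l _ ↦ (hA a l).smul (hv2 _ _)).of_le (by exact_mod_cast le_top)
  have hT2s : ContDiff ℝ k fun z ↦ 𝔟s z (fderiv ℝ (fun y ↦ cut y • u y) z) := by
    have heq : (fun z ↦ 𝔟s z (fderiv ℝ (fun y ↦ cut y • u y) z)) = fun z ↦
        ∑ l, (cutP z • ((𝔟s z).comp (ContinuousLinearMap.smulRightL ℝ E' F'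
          (innerSL ℝ (stdOrthonormalBasis ℝ E' l)))))
          (fderiv ℝ (fun y ↦ cut y • u y) z (stdOrthonormalBasis ℝ E' l)) :=
      funext fun z ↦ first_eq_sum_cutP h1 𝔟s u z
    rw [heq]
    exact (ContDiff.sum fun l _ ↦ (hB l).clm_apply (hv1 _)).of_le (by exact_mod_cast le_top)
  have hT3s : ContDiff ℝ k fun z ↦ 𝔠s z (cut z • u z) := by
    have heq : (fun z ↦ 𝔠s z (cut z • u z)) = fun z ↦ (cutP z • 𝔠s z) (cut z • u z) := by
      funext z
      rw [smul_apply]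
      refine (cutP_smul_eq h1 fun hz ↦ ?_).symm
      rw [image_eq_zero_of_notMem_tsupport hz, zero_smul, map_zero]
    rw [heq]
    exact (hCf.clm_apply (hcut.smul hu)).of_le (by exact_mod_cast le_top)
  have hT4s : ContDiff ℝ k fun z ↦ (2 • ∑ l, fderiv ℝ cut z (stdOrthonormalBasis ℝ E' l) •
      fderiv ℝ u z (stdOrthonormalBasis ℝ E' l)) :=
    ((ContDiff.sum fun l _ ↦ (hc1s l).smul (hd1s _)).const_smul _).of_le (by exact_mod_cast le_top)
  have hT5s : ContDiff ℝ k fun z ↦ (Δ cut) z • u z := (hcLs.smul hu).of_le (by exact_mod_cast le_top)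
  have hTTs : ∀ j, ContDiff ℝ k (TT j) := by
    intro j
    fin_cases j
    · exact hT1s
    · exact hT2s
    · exact hT3s
    · exact hT4s
    · exact hT5s
  have hsplit : flatErr Ss 𝔟s 𝔠s cut u = fun z ↦ ∑ j, TT j z := by
    funext z
    rw [flatErr_apply, Fin.sum_univ_five]
    simp only [hTT, Matrix.cons_val_zero, Matrix.cons_val_one, Matrix.head_cons, Matrix.cons_val_two,
      Matrix.tail_cons, Matrix.cons_val_three, Matrix.cons_val_four]
  rw [hsplit]
  have hsum : sobolevEnergy k (fun z ↦ ∑ j, TT j z) ≤ 5 * ∑ j, sobolevEnergy k (TT j) := by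
    have h := sobolevEnergy_sum_le_card k (Finset.univ : Finset (Fin 5)) (f := TT) fun j _ ↦ hTTs j
    simpa using h
  refine hsum.trans ?_
  rw [Fin.sum_univ_five]
  simp only [hTT, Matrix.cons_val_zero, Matrix.cons_val_one, Matrix.head_cons, Matrix.cons_val_two,
    Matrix.tail_cons, Matrix.cons_val_three, Matrix.cons_val_four]
  -- the arithmetic
  have hX : ENNReal.ofReal (80 * (Module.finrank ℝ E' : ℝ) ^ 2 * η ^ 2) =
      5 * (ENNReal.ofReal (16 * η ^ 2) * (N * N)) := by
    rw [hN, show (80 * (Module.finrank ℝ E' : ℝ) ^ 2 * η ^ 2) = 5 * ((16 * η ^ 2) *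
      ((Module.finrank ℝ E' : ℝ) * (Module.finrank ℝ E' : ℝ))) by ring, ENNReal.ofReal_mul (by norm_num),
      ENNReal.ofReal_mul (by positivity), ENNReal.ofReal_mul (Nat.cast_nonneg _), ENNReal.ofReal_natCast]
    norm_num
  calc 5 * (sobolevEnergy k (fun z ↦ principalPart (Ss z - 1) (fun y ↦ cut y • u y) z) +
        sobolevEnergy k (fun z ↦ 𝔟s z (fderiv ℝ (fun y ↦ cut y • u y) z)) +
        sobolevEnergy k (fun z ↦ 𝔠s z (cut z • u z)) +
        sobolevEnergy k (fun z ↦ (2 • ∑ l, fderiv ℝ cut z (stdOrthonormalBasis ℝ E' l) •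
          fderiv ℝ u z (stdOrthonormalBasis ℝ E' l))) +
        sobolevEnergy k (fun z ↦ (Δ cut) z • u z))
      ≤ 5 * ((ENNReal.ofReal (16 * η ^ 2) * (N * N) * ∑ a, ∑ l, Eu2 a l + N * N * (N * N) * K₁ * U * LOWu) +
          4 * N * N * Ccl * Ccr * U * LOWu + Ccl * Ccr * U * LOWu + 4 * N * N * Ccr * U * LOWu + Ccr * U * LOWu) :=
        mul_le_mul' le_rfl (add_le_add (add_le_add (add_le_add (add_le_add T1 T2) T3) T4) T5)
    _ = 5 * (ENNReal.ofReal (16 * η ^ 2) * (N * N)) * ∑ a, ∑ l, Eu2 a l +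
        5 * (N * N * (N * N) * K₁ + 4 * N * N * Ccl * Ccr + Ccl * Ccr + 4 * N * N * Ccr + Ccr) * U * LOWu := by ring
    _ = ENNReal.ofReal (80 * (Module.finrank ℝ E' : ℝ) ^ 2 * η ^ 2) * ∑ a, ∑ l, Eu2 a l + C * U * LOWu := by
        rw [hX, hC, hK₁]
        try ring
    _ = _ := by rw [hEu2, hU, hLOWu, hEu1, hEuu]

end Energy

/-! ### In time: the cut-off flat local solution and its weighted residual energy -/

section Time

open Literature.Analysis.FluidPDE TopologicalSpace

variable [MeasurableSpace E'] [BorelSpace E'] [FiniteDimensional ℝ F'] {T : ℝ}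

/-- **The flat local solution**: the zero-initial-value Duhamel solution of `∂ₜw = Δw + Θ` with the
slab data extended in time. [cite: Evans2010, §2.3.1, Thm. 2] -/
def flatLocalSol (T : ℝ) (Θ : ℝ → E' → F') : ℝ → E' → F' := heatDuhamelZero 1 (slabExtend T Θ)

variable {Θ : ℝ → E' → F'} {K : Set E'}

omit [FiniteDimensional ℝ E'] [MeasurableSpace E'] [BorelSpace E'] in
/-- The extended data are a space-time test field. [folklore] -/
theorem isSpaceTimeTestOn_slabExtend_of_slab (hT : 0 < T) (hΘ : IsSmoothSpaceTimeOn (Icc 0 T) Θ)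
    (hK : IsCompact K) (hΘK : ∀ s, ∀ z ∉ K, Θ s z = 0) :
    IsSpaceTimeTestOn (⊤ : Opens (ℝ × E')) (slabExtend T Θ) := by
  haveI : CompleteSpace F' := FiniteDimensional.complete ℝ F'
  exact isSpaceTimeTestOn_slabExtend hT hΘ hK hΘK

/-- The flat local solution is slab-smooth. [folklore] -/
theorem isSmoothSpaceTimeOn_flatLocalSol (hT : 0 < T) (hΘ : IsSmoothSpaceTimeOn (Icc 0 T) Θ)
    (hK : IsCompact K) (hΘK : ∀ s, ∀ z ∉ K, Θ s z = 0) : IsSmoothSpaceTimeOn (Icc 0 T) (flatLocalSol T Θ) :=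
  isSmoothSpaceTimeOn_heatDuhamelZero_Icc (isSpaceTimeTestOn_slabExtend_of_slab hT hΘ hK hΘK) one_pos T

omit [FiniteDimensional ℝ F'] in
/-- The flat local solution vanishes at `t = 0`. [folklore] -/
theorem flatLocalSol_zero (T : ℝ) (Θ : ℝ → E' → F') : flatLocalSol T Θ 0 = 0 := heatDuhamelZero_zero 1 _

/-- The slices of the flat local solution are smooth. [folklore] -/
theorem contDiff_flatLocalSol (hT : 0 < T) (hΘ : IsSmoothSpaceTimeOn (Icc 0 T) Θ) (hK : IsCompact K)
    (hΘK : ∀ s, ∀ z ∉ K, Θ s z = 0) (t : ℝ) : ContDiff ℝ ∞ (flatLocalSol T Θ t) :=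
  contDiff_heatDuhamelZero (isSpaceTimeTestOn_slabExtend_of_slab hT hΘ hK hΘK) one_pos t

/-- **The flat heat equation with source on the slab**: `∂ₜw = Δw + Θ` within `[0, T]`.
[cite: Evans2010, §2.3.1, Thm. 2] -/
theorem hasDerivWithinAt_flatLocalSol (hT : 0 < T) (hΘ : IsSmoothSpaceTimeOn (Icc 0 T) Θ) (hK : IsCompact K)
    (hΘK : ∀ s, ∀ z ∉ K, Θ s z = 0) {t : ℝ} (ht : t ∈ Icc 0 T) (z : E') :
    HasDerivWithinAt (fun s ↦ flatLocalSol T Θ s z) ((Δ (flatLocalSol T Θ t)) z + Θ t z) (Icc 0 T) t := by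
  have h := hasDerivWithinAt_heatDuhamelZero (isSpaceTimeTestOn_slabExtend_of_slab hT hΘ hK hΘK) one_pos ht.1 z
  rw [one_smul, slabExtend_apply_of_mem ht] at h
  exact h.mono Icc_subset_Ici_self

/-- The time derivative within the slab of the flat local solution. [folklore] -/
theorem timeDerivWithin_flatLocalSol (hT : 0 < T) (hΘ : IsSmoothSpaceTimeOn (Icc 0 T) Θ) (hK : IsCompact K)
    (hΘK : ∀ s, ∀ z ∉ K, Θ s z = 0) {t : ℝ} (ht : t ∈ Icc 0 T) (z : E') :
    timeDerivWithin (Icc 0 T) (flatLocalSol T Θ) t z = (Δ (flatLocalSol T Θ t)) z + Θ t z := by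
  rw [timeDerivWithin_apply]
  exact (hasDerivWithinAt_flatLocalSol hT hΘ hK hΘK ht z).derivWithin (uniqueDiffOn_Icc hT t ht)

/-- **The cut-off flat local solution** `ṽ = cut • w` is slab-smooth. [folklore] -/
theorem isSmoothSpaceTimeOn_cut_smul_flatLocalSol (hT : 0 < T) (hΘ : IsSmoothSpaceTimeOn (Icc 0 T) Θ)
    (hK : IsCompact K) (hΘK : ∀ s, ∀ z ∉ K, Θ s z = 0) {cut : E' → ℝ} (hcut : ContDiff ℝ ∞ cut) :
    IsSmoothSpaceTimeOn (Icc 0 T) fun s z ↦ cut z • flatLocalSol T Θ s z :=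
  (isSmoothSpaceTimeOn_const_time hcut _).smul (isSmoothSpaceTimeOn_flatLocalSol hT hΘ hK hΘK)

/-- The time derivative of the cut-off flat local solution: `∂ₜ(cut • w) = cut • (Δw + Θ)`.
[folklore] -/
theorem timeDerivWithin_cut_smul_flatLocalSol (hT : 0 < T) (hΘ : IsSmoothSpaceTimeOn (Icc 0 T) Θ)
    (hK : IsCompact K) (hΘK : ∀ s, ∀ z ∉ K, Θ s z = 0) (cut : E' → ℝ) {t : ℝ} (ht : t ∈ Icc 0 T) (z : E') :
    timeDerivWithin (Icc 0 T) (fun s z ↦ cut z • flatLocalSol T Θ s z) t z =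
      cut z • ((Δ (flatLocalSol T Θ t)) z + Θ t z) := by
  rw [timeDerivWithin_apply]
  exact ((hasDerivWithinAt_flatLocalSol hT hΘ hK hΘK ht z).const_smul (cut z)).derivWithin
    (uniqueDiffOn_Icc hT t ht)

/-- **The residual identity of the cut-off flat local solution against the variable-coefficient
operator**: `∂ₜṽ = frameOp (S t z) (𝔟 t z) (𝔠 t z) ṽ + cut • Θ - flatErr` on the slab.
[cite: Evans2010, §7.1.3] -/
theorem timeDerivWithin_cut_smul_flatLocalSol_eq (hT : 0 < T) (hΘ : IsSmoothSpaceTimeOn (Icc 0 T) Θ)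
    (hK : IsCompact K) (hΘK : ∀ s, ∀ z ∉ K, Θ s z = 0) {cut : E' → ℝ} (hcut : ContDiff ℝ ∞ cut)
    (S : ℝ → E' → (E' →L[ℝ] E')) (𝔟 : ℝ → E' → ((E' →L[ℝ] F') →L[ℝ] F')) (𝔠 : ℝ → E' → (F' →L[ℝ] F'))
    {t : ℝ} (ht : t ∈ Icc 0 T) (z : E') :
    timeDerivWithin (Icc 0 T) (fun s z ↦ cut z • flatLocalSol T Θ s z) t z =
      frameOp (S t z) (𝔟 t z) (𝔠 t z) (fun y ↦ cut y • flatLocalSol T Θ t y) z + cut z • Θ t z -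
        flatErr (S t) (𝔟 t) (𝔠 t) cut (flatLocalSol T Θ t) z := by
  rw [timeDerivWithin_cut_smul_flatLocalSol hT hΘ hK hΘK cut ht z]
  exact cut_smul_heat_eq (S t) (𝔟 t) (𝔠 t) hcut (contDiff_flatLocalSol hT hΘ hK hΘK t)
    (uₜ := fun z ↦ (Δ (flatLocalSol T Θ t)) z + Θ t z) z rfl

omit [MeasurableSpace E'] [BorelSpace E'] [FiniteDimensional ℝ F'] in
/-- **The flat residual of a slab-smooth family is slab-smooth** (slab-smooth coefficient fields,
smooth cut-off). [folklore] -/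
theorem isSmoothSpaceTimeOn_flatErr (hT : 0 < T) {S : ℝ → E' → (E' →L[ℝ] E')}
    {𝔟 : ℝ → E' → ((E' →L[ℝ] F') →L[ℝ] F')} {𝔠 : ℝ → E' → (F' →L[ℝ] F')}
    (hS : IsSmoothSpaceTimeOn (Icc 0 T) S) (h𝔟 : IsSmoothSpaceTimeOn (Icc 0 T) 𝔟) (h𝔠 : IsSmoothSpaceTimeOn (Icc 0 T) 𝔠)
    {cut : E' → ℝ} (hcut : ContDiff ℝ ∞ cut) {u : ℝ → E' → F'} (hu : IsSmoothSpaceTimeOn (Icc 0 T) u) :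
    IsSmoothSpaceTimeOn (Icc 0 T) fun s ↦ flatErr (S s) (𝔟 s) (𝔠 s) cut (u s) := by
  have hv : IsSmoothSpaceTimeOn (Icc 0 T) fun s z ↦ cut z • u s z := (isSmoothSpaceTimeOn_const_time hcut _).smul hu
  have hv1 : ∀ w, IsSmoothSpaceTimeOn (Icc 0 T) fun s z ↦ fderiv ℝ (fun y ↦ cut y • u s y) z w := fun w ↦
    isSmoothSpaceTimeOn_fderiv_apply_Icc hT hv w
  have hv2 : ∀ w w', IsSmoothSpaceTimeOn (Icc 0 T) fun s z ↦
      fderiv ℝ (fun y ↦ fderiv ℝ (fun x ↦ cut x • u s x) y w) z w' := fun w w' ↦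
    isSmoothSpaceTimeOn_fderiv_apply_Icc hT (hv1 w) w'
  have hd1 : ∀ w, IsSmoothSpaceTimeOn (Icc 0 T) fun s z ↦ fderiv ℝ (u s) z w := fun w ↦
    isSmoothSpaceTimeOn_fderiv_apply_Icc hT hu w
  -- the five terms
  have hP : IsSmoothSpaceTimeOn (Icc 0 T) fun s z ↦ principalPart (S s z - 1) (fun y ↦ cut y • u s y) z := by
    have heq : (fun s z ↦ principalPart (S s z - 1) (fun y ↦ cut y • u s y) z) = fun s z ↦ ∑ a, ∑ l,
        ⟪stdOrthonormalBasis ℝ E' a, (S s z - 1) (stdOrthonormalBasis ℝ E' l)⟫ •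
        fderiv ℝ (fun y ↦ fderiv ℝ (fun x ↦ cut x • u s x) y (stdOrthonormalBasis ℝ E' l)) z
          (stdOrthonormalBasis ℝ E' a) := by
      funext s z; rw [principalPart_apply]
    rw [heq]
    unfold IsSmoothSpaceTimeOn at hS hv2 ⊢
    have hc : ∀ a l, ContDiffOn ℝ ∞ (fun q : ℝ × E' ↦ ⟪stdOrthonormalBasis ℝ E' a, (S q.1 q.2 - 1)
        (stdOrthonormalBasis ℝ E' l)⟫) (Icc 0 T ×ˢ univ) := fun a l ↦
      contDiffOn_const.inner ℝ ((hS.sub contDiffOn_const).clm_apply contDiffOn_const)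
    have : (uncurry fun s z ↦ ∑ a, ∑ l, ⟪stdOrthonormalBasis ℝ E' a, (S s z - 1) (stdOrthonormalBasis ℝ E' l)⟫ •
        fderiv ℝ (fun y ↦ fderiv ℝ (fun x ↦ cut x • u s x) y (stdOrthonormalBasis ℝ E' l)) z
          (stdOrthonormalBasis ℝ E' a)) = fun q : ℝ × E' ↦ ∑ a, ∑ l, ⟪stdOrthonormalBasis ℝ E' a, (S q.1 q.2 - 1)
          (stdOrthonormalBasis ℝ E' l)⟫ • (uncurry fun s z ↦ fderiv ℝ (fun y ↦ fderiv ℝ (fun x ↦ cut x • u s x) y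
            (stdOrthonormalBasis ℝ E' l)) z (stdOrthonormalBasis ℝ E' a)) q := by
      funext ⟨s, z⟩; rfl
    rw [this]
    exact ContDiffOn.sum fun a _ ↦ ContDiffOn.sum fun l _ ↦ (hc a l).smul (hv2 _ _)
  have hB : IsSmoothSpaceTimeOn (Icc 0 T) fun s z ↦ 𝔟 s z (fderiv ℝ (fun y ↦ cut y • u s y) z) :=
    h𝔟.clm_apply (hv.fderiv_slice (uniqueDiffOn_Icc hT))
  have hC : IsSmoothSpaceTimeOn (Icc 0 T) fun s z ↦ 𝔠 s z (cut z • u s z) := h𝔠.clm_apply hv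
  have h7 : IsSmoothSpaceTimeOn (Icc 0 T) fun s z ↦ (2 : ℝ) • ∑ l, fderiv ℝ cut z (stdOrthonormalBasis ℝ E' l) •
      fderiv ℝ (u s) z (stdOrthonormalBasis ℝ E' l) := by
    have hsum : IsSmoothSpaceTimeOn (Icc 0 T) fun s z ↦ ∑ l, fderiv ℝ cut z (stdOrthonormalBasis ℝ E' l) •
        fderiv ℝ (u s) z (stdOrthonormalBasis ℝ E' l) := by
      unfold IsSmoothSpaceTimeOn
      have : (uncurry fun s z ↦ ∑ l, fderiv ℝ cut z (stdOrthonormalBasis ℝ E' l) • fderiv ℝ (u s) z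
          (stdOrthonormalBasis ℝ E' l)) = fun q : ℝ × E' ↦ ∑ l, (uncurry fun s z ↦ fderiv ℝ cut z (stdOrthonormalBasis ℝ E' l) •
            fderiv ℝ (u s) z (stdOrthonormalBasis ℝ E' l)) q := by
        funext ⟨s, z⟩; rfl
      rw [this]
      exact ContDiffOn.sum fun l _ ↦ ((isSmoothSpaceTimeOn_const_time (contDiff_fderiv_apply_of_contDiff hcut _) _).smul (hd1 _))
    exact hsum.const_smul 2
  have h8 : IsSmoothSpaceTimeOn (Icc 0 T) fun s z ↦ (Δ cut) z • u s z :=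
    (isSmoothSpaceTimeOn_const_time (contDiff_laplacian_of_contDiff hcut) _).smul hu
  have heq : (fun s ↦ flatErr (S s) (𝔟 s) (𝔠 s) cut (u s)) = fun s z ↦
      principalPart (S s z - 1) (fun y ↦ cut y • u s y) z + 𝔟 s z (fderiv ℝ (fun y ↦ cut y • u s y) z) +
      𝔠 s z (cut z • u s z) +
      (2 : ℝ) • (∑ l, fderiv ℝ cut z (stdOrthonormalBasis ℝ E' l) • fderiv ℝ (u s) z (stdOrthonormalBasis ℝ E' l)) +
      (Δ cut) z • u s z := by
    funext s z
    rw [flatErr_apply, two_smul, two_smul]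
  rw [heq]
  exact (((hP.add hB).add hC).add h7).add h8

omit [FiniteDimensional ℝ F'] in
/-- Measurability in time of slice energies of slab-smooth fields on `(0, t) ⊆ [0, T]`. [folklore] -/
theorem aemeasurable_sobolevEnergy_slice_Ioo' {f : ℝ → E' → F'} (hf : IsSmoothSpaceTimeOn (Icc 0 T) f)
    (k : ℕ) {t : ℝ} (ht : t ≤ T) :
    AEMeasurable (fun s ↦ sobolevEnergy k (f s)) (volume.restrict (Ioo 0 t)) :=
  aemeasurable_sobolevEnergy_slice isOpen_Ioo k (hf.mono fun _ hs ↦ ⟨hs.1.le, hs.2.le.trans ht⟩)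

/-- **The weighted residual energy of the cut-off flat local solution.** If at every time of the
slab `E_k(flatErr(s)) ≤ A Σ E_k(∂∂w(s)) + B (Σ E_k(∂w(s)) + E_k(w(s)))` (e.g. from
`sobolevEnergy_flatErr_le` with `A = 80 n² η²`, `B = C (Mc²+1) Mcut²` and bounds uniform in `s`),
then for `λ > 0`, `t ∈ [0, T]`:
`∫₀ᵗ e^{-2λs} E_k(flatErr(s)) ds ≤ (A n + B (λ⁻¹/2 + λ⁻²)) ∫₀ᵗ e^{-2λs} E_k(Θ(s)) ds`
— the global heat engine for the Duhamel solution: maximal regularity `n`, gains `λ⁻¹/2`,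
`λ⁻²`. [cite: Evans2010, §7.1.3] -/
theorem lintegral_weight_sobolevEnergy_flatErr_le (hT : 0 < T) (hΘ : IsSmoothSpaceTimeOn (Icc 0 T) Θ)
    (hK : IsCompact K) (hΘK : ∀ s, ∀ z ∉ K, Θ s z = 0) (k : ℕ) {A B : ℝ≥0∞}
    {S : ℝ → E' → (E' →L[ℝ] E')} {𝔟 : ℝ → E' → ((E' →L[ℝ] F') →L[ℝ] F')} {𝔠 : ℝ → E' → (F' →L[ℝ] F')}
    {cut : E' → ℝ}
    (hslice : ∀ s ∈ Icc 0 T, sobolevEnergy k (flatErr (S s) (𝔟 s) (𝔠 s) cut (flatLocalSol T Θ s)) ≤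
      A * ∑ a, ∑ l, sobolevEnergy k (fun y ↦ fderiv ℝ (fun z ↦ fderiv ℝ (flatLocalSol T Θ s) z
        (stdOrthonormalBasis ℝ E' l)) y (stdOrthonormalBasis ℝ E' a)) +
      B * (∑ l, sobolevEnergy k (fun z ↦ fderiv ℝ (flatLocalSol T Θ s) z (stdOrthonormalBasis ℝ E' l)) +
        sobolevEnergy k (flatLocalSol T Θ s)))
    {lam : ℝ} (hlam : 0 < lam) {t : ℝ} (ht : t ∈ Icc 0 T) :
    ∫⁻ s in Ioo 0 t, ENNReal.ofReal (Real.exp (-2 * lam * s)) *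
        sobolevEnergy k (flatErr (S s) (𝔟 s) (𝔠 s) cut (flatLocalSol T Θ s)) ≤
      (A * (Module.finrank ℝ E' : ℝ≥0∞) + B * (ENNReal.ofReal (lam⁻¹ / 2) + ENNReal.ofReal (lam⁻¹ ^ 2))) *
        ∫⁻ s in Ioo 0 t, ENNReal.ofReal (Real.exp (-2 * lam * s)) * sobolevEnergy k (Θ s) := by
  have hext := isSpaceTimeTestOn_slabExtend_of_slab hT hΘ hK hΘK
  set W : ℝ → ℝ≥0∞ := fun s ↦ ENNReal.ofReal (Real.exp (-2 * lam * s)) with hW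
  have hWm : AEMeasurable W (volume.restrict (Ioo 0 t)) :=
    (Real.continuous_exp.comp (continuous_const.mul continuous_id)).measurable.ennreal_ofReal.aemeasurable
  set w := flatLocalSol T Θ with hw
  have hws : IsSmoothSpaceTimeOn (Icc 0 T) w := isSmoothSpaceTimeOn_flatLocalSol hT hΘ hK hΘK
  -- the engine (global, for the Duhamel solution with the extended data)
  have hdata : ∫⁻ s in Ioo 0 t, W s * sobolevEnergy k (slabExtend T Θ s) = ∫⁻ s in Ioo 0 t, W s * sobolevEnergy k (Θ s) := by
    refine setLIntegral_congr_fun measurableSet_Ioo fun s hs ↦ ?_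
    rw [slabExtend_eq_of_mem ⟨hs.1.le, hs.2.le.trans ht.2⟩]
  have hX : ∫⁻ s in Ioo 0 t, W s * ∑ a, ∑ l, sobolevEnergy k (fun y ↦ fderiv ℝ (fun z ↦ fderiv ℝ (w s) z
      (stdOrthonormalBasis ℝ E' l)) y (stdOrthonormalBasis ℝ E' a)) ≤
      (Module.finrank ℝ E' : ℝ≥0∞) * ∫⁻ s in Ioo 0 t, W s * sobolevEnergy k (Θ s) := by
    have h := lintegral_weight_sum_sobolevEnergy_fderiv_fderiv_heatDuhamelZero_le (E := E') (F' := F') one_pos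
      hlam.le k hext ht.1
    rw [one_pow, div_one, ENNReal.ofReal_natCast] at h
    rw [← hdata]
    refine le_trans (le_of_eq ?_) h
    refine lintegral_congr fun s ↦ ?_
    rw [Finset.sum_comm]
    rfl
  have hY : ∫⁻ s in Ioo 0 t, W s * ∑ l, sobolevEnergy k (fun z ↦ fderiv ℝ (w s) z (stdOrthonormalBasis ℝ E' l)) ≤
      ENNReal.ofReal (lam⁻¹ / 2) * ∫⁻ s in Ioo 0 t, W s * sobolevEnergy k (Θ s) := by
    have h := lintegral_weight_sum_sobolevEnergy_fderiv_heatDuhamelZero_le (E := E') (F' := F') one_pos hlam k hext ht.1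
    rw [mul_one] at h
    rwa [← hdata]
  have hZ : ∫⁻ s in Ioo 0 t, W s * sobolevEnergy k (w s) ≤
      ENNReal.ofReal (lam⁻¹ ^ 2) * ∫⁻ s in Ioo 0 t, W s * sobolevEnergy k (Θ s) := by
    have h := lintegral_weight_sobolevEnergy_heatDuhamelZero_le (E := E') (F' := F') one_pos hlam k hext ht.1
    rwa [← hdata]
  -- measurability
  have hd1 : ∀ l, IsSmoothSpaceTimeOn (Icc 0 T) fun s y ↦ fderiv ℝ (w s) y (stdOrthonormalBasis ℝ E' l) :=
    fun l ↦ isSmoothSpaceTimeOn_fderiv_apply_Icc hT hws _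
  have hd2 : ∀ a l, IsSmoothSpaceTimeOn (Icc 0 T) fun s y ↦
      fderiv ℝ (fun z ↦ fderiv ℝ (w s) z (stdOrthonormalBasis ℝ E' l)) y (stdOrthonormalBasis ℝ E' a) :=
    fun a l ↦ isSmoothSpaceTimeOn_fderiv_apply_Icc hT (hd1 l) _
  have mX : AEMeasurable (fun s ↦ ∑ a, ∑ l, sobolevEnergy k (fun y ↦ fderiv ℝ (fun z ↦ fderiv ℝ (w s) z
      (stdOrthonormalBasis ℝ E' l)) y (stdOrthonormalBasis ℝ E' a))) (volume.restrict (Ioo 0 t)) :=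
    Finset.aemeasurable_fun_sum _ fun a _ ↦ Finset.aemeasurable_fun_sum _ fun l _ ↦
      aemeasurable_sobolevEnergy_slice_Ioo' (hd2 a l) k ht.2
  have mY : AEMeasurable (fun s ↦ ∑ l, sobolevEnergy k (fun z ↦ fderiv ℝ (w s) z (stdOrthonormalBasis ℝ E' l)))
      (volume.restrict (Ioo 0 t)) :=
    Finset.aemeasurable_fun_sum _ fun l _ ↦ aemeasurable_sobolevEnergy_slice_Ioo' (hd1 l) k ht.2
  have mZ : AEMeasurable (fun s ↦ sobolevEnergy k (w s)) (volume.restrict (Ioo 0 t)) :=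
    aemeasurable_sobolevEnergy_slice_Ioo' hws k ht.2
  have mWX : AEMeasurable (fun s ↦ W s * (A * ∑ a, ∑ l, sobolevEnergy k (fun y ↦ fderiv ℝ (fun z ↦ fderiv ℝ (w s) z
      (stdOrthonormalBasis ℝ E' l)) y (stdOrthonormalBasis ℝ E' a)))) (volume.restrict (Ioo 0 t)) :=
    hWm.mul (mX.const_mul _)
  have mYZ : AEMeasurable (fun s ↦ ∑ l, sobolevEnergy k (fun z ↦ fderiv ℝ (w s) z (stdOrthonormalBasis ℝ E' l)) +
      sobolevEnergy k (w s)) (volume.restrict (Ioo 0 t)) := mY.add mZ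
  -- the two pieces
  have e1 : ∫⁻ s in Ioo 0 t, W s * (A * ∑ a, ∑ l, sobolevEnergy k (fun y ↦ fderiv ℝ (fun z ↦ fderiv ℝ (w s) z
      (stdOrthonormalBasis ℝ E' l)) y (stdOrthonormalBasis ℝ E' a))) =
      A * ∫⁻ s in Ioo 0 t, W s * ∑ a, ∑ l, sobolevEnergy k (fun y ↦ fderiv ℝ (fun z ↦ fderiv ℝ (w s) z
        (stdOrthonormalBasis ℝ E' l)) y (stdOrthonormalBasis ℝ E' a)) := by
    calc _ = ∫⁻ s in Ioo 0 t, A * (W s * ∑ a, ∑ l, sobolevEnergy k (fun y ↦ fderiv ℝ (fun z ↦ fderiv ℝ (w s) z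
          (stdOrthonormalBasis ℝ E' l)) y (stdOrthonormalBasis ℝ E' a))) := lintegral_congr fun s ↦ by ring
      _ = _ := lintegral_const_mul'' A (hWm.mul mX)
  have m1 : AEMeasurable (fun s ↦ W s * ∑ l, sobolevEnergy k (fun z ↦ fderiv ℝ (w s) z
      (stdOrthonormalBasis ℝ E' l))) (volume.restrict (Ioo 0 t)) := hWm.mul mY
  have e2 : ∫⁻ s in Ioo 0 t, W s * (B * (∑ l, sobolevEnergy k (fun z ↦ fderiv ℝ (w s) z (stdOrthonormalBasis ℝ E' l)) +
      sobolevEnergy k (w s))) =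
      B * ((∫⁻ s in Ioo 0 t, W s * ∑ l, sobolevEnergy k (fun z ↦ fderiv ℝ (w s) z (stdOrthonormalBasis ℝ E' l))) +
        ∫⁻ s in Ioo 0 t, W s * sobolevEnergy k (w s)) := by
    calc _ = ∫⁻ s in Ioo 0 t, B * (W s * ∑ l, sobolevEnergy k (fun z ↦ fderiv ℝ (w s) z
          (stdOrthonormalBasis ℝ E' l)) + W s * sobolevEnergy k (w s)) := lintegral_congr fun s ↦ by ring
      _ = B * ∫⁻ s in Ioo 0 t, (W s * ∑ l, sobolevEnergy k (fun z ↦ fderiv ℝ (w s) z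
          (stdOrthonormalBasis ℝ E' l)) + W s * sobolevEnergy k (w s)) :=
          lintegral_const_mul'' B ((hWm.mul mY).add (hWm.mul mZ))
      _ = _ := by rw [lintegral_add_left' m1]
  -- integrate the slice bound
  calc ∫⁻ s in Ioo 0 t, W s * sobolevEnergy k (flatErr (S s) (𝔟 s) (𝔠 s) cut (w s))
      ≤ ∫⁻ s in Ioo 0 t, (W s * (A * ∑ a, ∑ l, sobolevEnergy k (fun y ↦ fderiv ℝ (fun z ↦ fderiv ℝ (w s) z
          (stdOrthonormalBasis ℝ E' l)) y (stdOrthonormalBasis ℝ E' a))) +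
          W s * (B * (∑ l, sobolevEnergy k (fun z ↦ fderiv ℝ (w s) z (stdOrthonormalBasis ℝ E' l)) +
            sobolevEnergy k (w s)))) := by
        refine setLIntegral_mono' measurableSet_Ioo fun s hs ↦ ?_
        rw [← mul_add]
        exact mul_le_mul' le_rfl (hslice s ⟨hs.1.le, hs.2.le.trans ht.2⟩)
    _ = A * (∫⁻ s in Ioo 0 t, W s * ∑ a, ∑ l, sobolevEnergy k (fun y ↦ fderiv ℝ (fun z ↦ fderiv ℝ (w s) z
          (stdOrthonormalBasis ℝ E' l)) y (stdOrthonormalBasis ℝ E' a))) +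
        B * ((∫⁻ s in Ioo 0 t, W s * ∑ l, sobolevEnergy k (fun z ↦ fderiv ℝ (w s) z (stdOrthonormalBasis ℝ E' l))) +
          ∫⁻ s in Ioo 0 t, W s * sobolevEnergy k (w s)) := by
        rw [lintegral_add_left' mWX, e1, e2]
    _ ≤ A * ((Module.finrank ℝ E' : ℝ≥0∞) * ∫⁻ s in Ioo 0 t, W s * sobolevEnergy k (Θ s)) +
        B * (ENNReal.ofReal (lam⁻¹ / 2) * (∫⁻ s in Ioo 0 t, W s * sobolevEnergy k (Θ s)) +
          ENNReal.ofReal (lam⁻¹ ^ 2) * ∫⁻ s in Ioo 0 t, W s * sobolevEnergy k (Θ s)) :=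
        add_le_add (mul_le_mul' le_rfl hX) (mul_le_mul' le_rfl (add_le_add hY hZ))
    _ = _ := by ring

/-- **The weighted residual energy one order below the data** (gain of the sharp Leibniz rule's
lower term in the re-localisation): if at every time of the slab
`E_j(flatErr(s)) ≤ A Σ E_j(∂∂w(s)) + B (Σ E_j(∂w(s)) + E_j(w(s)))`, then for `λ > 0`, `t ∈ [0, T]`:
`∫₀ᵗ e^{-2λs} E_j(flatErr(s)) ds ≤ (A n (λ⁻¹/2) + B (λ⁻¹/2 + λ⁻²)) ∫₀ᵗ e^{-2λs} E_{j+1}(Θ(s)) ds`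
(`E_j(∂_a∂_b w) ≤ E_{j+1}(∂_b w)`, then the gradient gain at order `j+1`, monotonicity in the order).
[cite: Evans2010, §7.1.3] -/
theorem lintegral_weight_sobolevEnergy_flatErr_le_succ (hT : 0 < T) (hΘ : IsSmoothSpaceTimeOn (Icc 0 T) Θ)
    (hK : IsCompact K) (hΘK : ∀ s, ∀ z ∉ K, Θ s z = 0) (j : ℕ) {A B : ℝ≥0∞}
    {S : ℝ → E' → (E' →L[ℝ] E')} {𝔟 : ℝ → E' → ((E' →L[ℝ] F') →L[ℝ] F')} {𝔠 : ℝ → E' → (F' →L[ℝ] F')}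
    {cut : E' → ℝ}
    (hslice : ∀ s ∈ Icc 0 T, sobolevEnergy j (flatErr (S s) (𝔟 s) (𝔠 s) cut (flatLocalSol T Θ s)) ≤
      A * ∑ a, ∑ l, sobolevEnergy j (fun y ↦ fderiv ℝ (fun z ↦ fderiv ℝ (flatLocalSol T Θ s) z
        (stdOrthonormalBasis ℝ E' l)) y (stdOrthonormalBasis ℝ E' a)) +
      B * (∑ l, sobolevEnergy j (fun z ↦ fderiv ℝ (flatLocalSol T Θ s) z (stdOrthonormalBasis ℝ E' l)) +
        sobolevEnergy j (flatLocalSol T Θ s)))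
    {lam : ℝ} (hlam : 0 < lam) {t : ℝ} (ht : t ∈ Icc 0 T) :
    ∫⁻ s in Ioo 0 t, ENNReal.ofReal (Real.exp (-2 * lam * s)) *
        sobolevEnergy j (flatErr (S s) (𝔟 s) (𝔠 s) cut (flatLocalSol T Θ s)) ≤
      (A * (Module.finrank ℝ E' : ℝ≥0∞) * ENNReal.ofReal (lam⁻¹ / 2) +
          B * (ENNReal.ofReal (lam⁻¹ / 2) + ENNReal.ofReal (lam⁻¹ ^ 2))) *
        ∫⁻ s in Ioo 0 t, ENNReal.ofReal (Real.exp (-2 * lam * s)) * sobolevEnergy (j + 1) (Θ s) := by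
  -- reduce to the order-`(j+1)` slice bound shape with `A' = 0`: we bound the second-order energies by
  -- first-order ones one level up, then apply the order-`(j+1)` engine for gradients and the
  -- order-`j` engine (monotone in the order) for the rest.
  have hext := isSpaceTimeTestOn_slabExtend_of_slab hT hΘ hK hΘK
  set W : ℝ → ℝ≥0∞ := fun s ↦ ENNReal.ofReal (Real.exp (-2 * lam * s)) with hW
  have hWm : AEMeasurable W (volume.restrict (Ioo 0 t)) :=
    (Real.continuous_exp.comp (continuous_const.mul continuous_id)).measurable.ennreal_ofReal.aemeasurable
  set w := flatLocalSol T Θ with hw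
  have hws : IsSmoothSpaceTimeOn (Icc 0 T) w := isSmoothSpaceTimeOn_flatLocalSol hT hΘ hK hΘK
  have hdata : ∀ i, ∫⁻ s in Ioo 0 t, W s * sobolevEnergy i (slabExtend T Θ s) =
      ∫⁻ s in Ioo 0 t, W s * sobolevEnergy i (Θ s) := fun i ↦ by
    refine setLIntegral_congr_fun measurableSet_Ioo fun s hs ↦ ?_
    rw [slabExtend_eq_of_mem ⟨hs.1.le, hs.2.le.trans ht.2⟩]
  have hmono : ∫⁻ s in Ioo 0 t, W s * sobolevEnergy j (Θ s) ≤ ∫⁻ s in Ioo 0 t, W s * sobolevEnergy (j + 1) (Θ s) :=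
    lintegral_mono fun s ↦ mul_le_mul' le_rfl (sobolevEnergy_le_succ j _)
  -- second order at level `j` ≤ first order at level `j+1`
  have hpt : ∀ s, ∑ a, ∑ l, sobolevEnergy j (fun y ↦ fderiv ℝ (fun z ↦ fderiv ℝ (w s) z
      (stdOrthonormalBasis ℝ E' l)) y (stdOrthonormalBasis ℝ E' a)) ≤
      (Module.finrank ℝ E' : ℝ≥0∞) * ∑ l, sobolevEnergy (j + 1) (fun z ↦ fderiv ℝ (w s) z (stdOrthonormalBasis ℝ E' l)) := by
    intro s
    calc _ ≤ ∑ _a : Fin (Module.finrank ℝ E'), ∑ l, sobolevEnergy (j + 1) (fun z ↦ fderiv ℝ (w s) z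
          (stdOrthonormalBasis ℝ E' l)) := by
          refine Finset.sum_le_sum fun a _ ↦ Finset.sum_le_sum fun l _ ↦ ?_
          rw [sobolevEnergy_succ]
          refine le_trans ?_ le_add_self
          exact Finset.single_le_sum (f := fun i ↦ sobolevEnergy j fun y ↦
            fderiv ℝ (fun z ↦ fderiv ℝ (w s) z (stdOrthonormalBasis ℝ E' l)) y (stdOrthonormalBasis ℝ E' i))
            (fun _ _ ↦ bot_le) (Finset.mem_univ a)
      _ = _ := by rw [Finset.sum_const, Finset.card_univ, Fintype.card_fin, nsmul_eq_mul]
  -- the engine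
  have hY1 : ∫⁻ s in Ioo 0 t, W s * ∑ l, sobolevEnergy (j + 1) (fun z ↦ fderiv ℝ (w s) z (stdOrthonormalBasis ℝ E' l)) ≤
      ENNReal.ofReal (lam⁻¹ / 2) * ∫⁻ s in Ioo 0 t, W s * sobolevEnergy (j + 1) (Θ s) := by
    have h := lintegral_weight_sum_sobolevEnergy_fderiv_heatDuhamelZero_le (E := E') (F' := F') one_pos hlam (j + 1)
      hext ht.1
    rw [mul_one] at h
    rwa [← hdata]
  have hY : ∫⁻ s in Ioo 0 t, W s * ∑ l, sobolevEnergy j (fun z ↦ fderiv ℝ (w s) z (stdOrthonormalBasis ℝ E' l)) ≤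
      ENNReal.ofReal (lam⁻¹ / 2) * ∫⁻ s in Ioo 0 t, W s * sobolevEnergy (j + 1) (Θ s) := by
    have h := lintegral_weight_sum_sobolevEnergy_fderiv_heatDuhamelZero_le (E := E') (F' := F') one_pos hlam j hext ht.1
    rw [mul_one, hdata] at h
    exact h.trans (mul_le_mul' le_rfl hmono)
  have hZ : ∫⁻ s in Ioo 0 t, W s * sobolevEnergy j (w s) ≤
      ENNReal.ofReal (lam⁻¹ ^ 2) * ∫⁻ s in Ioo 0 t, W s * sobolevEnergy (j + 1) (Θ s) := by
    have h := lintegral_weight_sobolevEnergy_heatDuhamelZero_le (E := E') (F' := F') one_pos hlam j hext ht.1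
    rw [hdata] at h
    exact h.trans (mul_le_mul' le_rfl hmono)
  -- measurability
  have hd1 : ∀ l, IsSmoothSpaceTimeOn (Icc 0 T) fun s y ↦ fderiv ℝ (w s) y (stdOrthonormalBasis ℝ E' l) :=
    fun l ↦ isSmoothSpaceTimeOn_fderiv_apply_Icc hT hws _
  have mY1 : AEMeasurable (fun s ↦ ∑ l, sobolevEnergy (j + 1) (fun z ↦ fderiv ℝ (w s) z (stdOrthonormalBasis ℝ E' l)))
      (volume.restrict (Ioo 0 t)) :=
    Finset.aemeasurable_fun_sum _ fun l _ ↦ aemeasurable_sobolevEnergy_slice_Ioo' (hd1 l) (j + 1) ht.2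
  have mY : AEMeasurable (fun s ↦ ∑ l, sobolevEnergy j (fun z ↦ fderiv ℝ (w s) z (stdOrthonormalBasis ℝ E' l)))
      (volume.restrict (Ioo 0 t)) :=
    Finset.aemeasurable_fun_sum _ fun l _ ↦ aemeasurable_sobolevEnergy_slice_Ioo' (hd1 l) j ht.2
  have mZ : AEMeasurable (fun s ↦ sobolevEnergy j (w s)) (volume.restrict (Ioo 0 t)) :=
    aemeasurable_sobolevEnergy_slice_Ioo' hws j ht.2
  have mWX : AEMeasurable (fun s ↦ W s * (A * (Module.finrank ℝ E' : ℝ≥0∞) * ∑ l, sobolevEnergy (j + 1)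
      (fun z ↦ fderiv ℝ (w s) z (stdOrthonormalBasis ℝ E' l)))) (volume.restrict (Ioo 0 t)) :=
    hWm.mul (mY1.const_mul _)
  have m1 : AEMeasurable (fun s ↦ W s * ∑ l, sobolevEnergy j (fun z ↦ fderiv ℝ (w s) z
      (stdOrthonormalBasis ℝ E' l))) (volume.restrict (Ioo 0 t)) := hWm.mul mY
  have e1 : ∫⁻ s in Ioo 0 t, W s * (A * (Module.finrank ℝ E' : ℝ≥0∞) * ∑ l, sobolevEnergy (j + 1)
      (fun z ↦ fderiv ℝ (w s) z (stdOrthonormalBasis ℝ E' l))) =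
      A * (Module.finrank ℝ E' : ℝ≥0∞) * ∫⁻ s in Ioo 0 t, W s * ∑ l, sobolevEnergy (j + 1)
        (fun z ↦ fderiv ℝ (w s) z (stdOrthonormalBasis ℝ E' l)) := by
    calc _ = ∫⁻ s in Ioo 0 t, A * (Module.finrank ℝ E' : ℝ≥0∞) * (W s * ∑ l, sobolevEnergy (j + 1)
          (fun z ↦ fderiv ℝ (w s) z (stdOrthonormalBasis ℝ E' l))) := lintegral_congr fun s ↦ by ring
      _ = _ := lintegral_const_mul'' _ (hWm.mul mY1)
  have e2 : ∫⁻ s in Ioo 0 t, W s * (B * (∑ l, sobolevEnergy j (fun z ↦ fderiv ℝ (w s) z (stdOrthonormalBasis ℝ E' l)) +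
      sobolevEnergy j (w s))) =
      B * ((∫⁻ s in Ioo 0 t, W s * ∑ l, sobolevEnergy j (fun z ↦ fderiv ℝ (w s) z (stdOrthonormalBasis ℝ E' l))) +
        ∫⁻ s in Ioo 0 t, W s * sobolevEnergy j (w s)) := by
    calc _ = ∫⁻ s in Ioo 0 t, B * (W s * ∑ l, sobolevEnergy j (fun z ↦ fderiv ℝ (w s) z
          (stdOrthonormalBasis ℝ E' l)) + W s * sobolevEnergy j (w s)) := lintegral_congr fun s ↦ by ring
      _ = B * ∫⁻ s in Ioo 0 t, (W s * ∑ l, sobolevEnergy j (fun z ↦ fderiv ℝ (w s) z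
          (stdOrthonormalBasis ℝ E' l)) + W s * sobolevEnergy j (w s)) :=
          lintegral_const_mul'' B ((hWm.mul mY).add (hWm.mul mZ))
      _ = _ := by rw [lintegral_add_left' m1]
  calc ∫⁻ s in Ioo 0 t, W s * sobolevEnergy j (flatErr (S s) (𝔟 s) (𝔠 s) cut (w s))
      ≤ ∫⁻ s in Ioo 0 t, (W s * (A * (Module.finrank ℝ E' : ℝ≥0∞) * ∑ l, sobolevEnergy (j + 1)
          (fun z ↦ fderiv ℝ (w s) z (stdOrthonormalBasis ℝ E' l))) +
          W s * (B * (∑ l, sobolevEnergy j (fun z ↦ fderiv ℝ (w s) z (stdOrthonormalBasis ℝ E' l)) +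
            sobolevEnergy j (w s)))) := by
        refine setLIntegral_mono' measurableSet_Ioo fun s hs ↦ ?_
        rw [← mul_add]
        refine mul_le_mul' le_rfl ((hslice s ⟨hs.1.le, hs.2.le.trans ht.2⟩).trans ?_)
        refine add_le_add ?_ le_rfl
        rw [mul_assoc]
        exact mul_le_mul' le_rfl (hpt s)
    _ = A * (Module.finrank ℝ E' : ℝ≥0∞) * (∫⁻ s in Ioo 0 t, W s * ∑ l, sobolevEnergy (j + 1)
          (fun z ↦ fderiv ℝ (w s) z (stdOrthonormalBasis ℝ E' l))) +
        B * ((∫⁻ s in Ioo 0 t, W s * ∑ l, sobolevEnergy j (fun z ↦ fderiv ℝ (w s) z (stdOrthonormalBasis ℝ E' l))) +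
          ∫⁻ s in Ioo 0 t, W s * sobolevEnergy j (w s)) := by
        rw [lintegral_add_left' mWX, e1, e2]
    _ ≤ A * (Module.finrank ℝ E' : ℝ≥0∞) * (ENNReal.ofReal (lam⁻¹ / 2) * ∫⁻ s in Ioo 0 t, W s * sobolevEnergy (j + 1) (Θ s)) +
        B * (ENNReal.ofReal (lam⁻¹ / 2) * (∫⁻ s in Ioo 0 t, W s * sobolevEnergy (j + 1) (Θ s)) +
          ENNReal.ofReal (lam⁻¹ ^ 2) * ∫⁻ s in Ioo 0 t, W s * sobolevEnergy (j + 1) (Θ s)) :=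
        add_le_add (mul_le_mul' le_rfl hY1) (mul_le_mul' le_rfl (add_le_add hY hZ))
    _ = _ := by ring

end Time

end Literature.Analysis.PDE

end
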